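import Summits.BirchSwinnertonDyer.BirchSwinnertonDyer.Theses.UniversalToricDescent
import Summits.BirchSwinnertonDyer.BirchSwinnertonDyer.Theorems.UniversalToricDescentAcDualMuZeroCriterion
import HarnessLib

/-!
# utd-idea g64 — the CHARACTERWISE ONE-POINT SQUEEZE for crux 24737 `TwinAlgMuZeroAtThree`

Crux (verbatim, route file l.566): `μ^alg = 0 ∧ Λ-torsion` for Castella's dual
`X′ = XAc (W′/K) 3 κ 𝔭′ ∅ γ` of a bucket-B / bucket-C₀ twin `E′` at `p = 3`.

MECHANISM.  For a finitely generated `Λ = ℤ₃⟦T⟧`-module `X` and the character polynomials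
`Φ_m := Φ_{3^m}(1+T)` (`cycLayer m`), the integers `log₃ #(X/Φ_m X)` read the invariants:
`log₃ #(X/Φ_m X) = μ(X)·φ(3^m) + λ(X) + O(1)` (`m ≫ 0`).  Hence (`BoundedCharLayersCriterion`, pure algebra,
Nakayama over `Λ/3 = 𝔽₃⟦T⟧` since `Φ_m ≡ T^{φ(3^m)} (mod 3)`): **bounded character layers ⟹ `X/3X` finite ⟹
`X` finitely generated over `ℤ₃` ⟹ torsion ∧ μ = 0** (tree bricks `moduleFinite_padicInt_of_finite_quotient_augIdealP`,
`finite_pTorsion_of_moduleFinite_padicInt`, `isTorsion_and_exists_generator_of_finite_pTorsion`; composed and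
kernel-checked below as `conclusion_of_boundedCharLayers`).  The ARITHMETIC input is then ONE finite-level
inequality per character `χ` of conductor `3^m` (`TwistedOnePointKolyvaginAtThree`, the transfer `C⁺`):
`#(X′/Φ_m X′) · ‖L′(ζ_χ − 1)‖^{φ(3^m)} ≤ 3^B` uniformly in `m` — finite-level `χ`-twisted Heegner–Kolyvagin over `K`
(the GLOBAL index of the Heegner class CANCELS in the Poitou–Tate comparison `(∅,0)` vs. Bloch–Kato; complex
conjugation swaps `χ ↔ χ̄`, `𝔭 ↔ 𝔭′`), `p`-adic Waldspurger at the RAMIFIED character `χ` (local index of `z_χ` at `𝔭′`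
= `v(L′(χ))` up to a local resolvent term), control at `χ`.  With the analytic `μ(L′) = 0` (kernel input
`TwinMuZeroAtThree`, read frame-wise as `UnitCoeffValuesAtTorsionPoints`: `‖L′(ζ−1)‖ = ‖ζ−1‖^{λ′}` for `m ≫ 0`) and
`‖ζ−1‖^{φ(3^m)} = ‖3‖`, the right-hand side is `3^{B+λ′}`: bounded character layers, done.  No `Λ`-adic class, no
local indivisibility `(β)`, no `±`/signed theory, slack `3^B` allowed (μ is an integer).

Nothing here is a route item; `TwistedOnePointKolyvaginAtThree` is the card's `C⁺`, the rest are support Props and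
PROVED theorems: §1 `conclusion_of_boundedCharLayers` (endgame, modulo P2), §4 `boundedCharLayers_of_squeeze`
(K1 + P1 + P0 ⟹ bounded layers), §5 `boundedCharLayersCriterion_holds` (**P2 PROVED**: Nakayama over `Λ/3`) and the
unconditional endgame `conclusion_of_boundedCharLayers'`, §6 **P0 PROVED** (`primitiveRootNormAtThree_holds`) with the
existence of primitive roots / of values discharged, §7 **P1 PROVED** (`unitCoeffValuesAtTorsionPoints_holds`, elementary
ultrametric estimate), §8 **`TwinAlgMuZeroAtThree_of_onePointSqueeze : C⁺ → TwinFrameMuSupplyAtThree → TwinAlgMuZeroAtThree`**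
(concludes the crux BY NAME; the only open inputs are the finite-level arithmetic statement `C⁺` and the frame's analytic μ),
§9 SLACK VARIANT (typing checklist 4c(iv)): `C⁺_slack` (bound `3^{c·φ(3^m)+B}`, some `c < 1`), `slack_of_C_plus` (PROVED),
`TwinAlgMuZeroAtThree_of_onePointSqueezeSlack : P2′ → C⁺_slack → TwinFrameMuSupplyAtThree → TwinAlgMuZeroAtThree` (PROVED modulo
the typed structure-theory criterion P2′ `SublinearCharLayersCriterion`), §10 SPARSE-LEVEL VARIANT (all PROVED): the squeeze asserted
only along an UNBOUNDED set of levels `m` (`C⁺_sparse`, e.g. one parity class of conductor exponents — what the printed `a₃ = 0`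
reciprocity law `φ(ℒ_𝔭(f)) = 𝔤(χ_φ⁻¹)χ_φ(pⁿ)p⁻ⁿ Σ_σ χ(σ) log_{ω_f}(z_{pⁿ}^σ)` for `n` EVEN, arXiv:1506.02538 p. 10, supplies) already gives
the crux: `finite_augQuot_of_frequentlyBoundedCharLayers` (P2-sparse), `sparse_of_C_plus`,
**`TwinAlgMuZeroAtThree_of_onePointSqueezeSparse : C⁺_sparse → TwinFrameMuSupplyAtThree → TwinAlgMuZeroAtThree`**.  Sorry-free.
-/

noncomputable section

-- `…BirchSwinnertonDyer.BirchSwinnertonDyer…` is the problem's mandated namespace (D-0017).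
set_option linter.dupNamespace false
set_option autoImplicit false

open Literature.NumberTheory.EllipticCurves Literature.NumberTheory.EllipticCurves.IwasawaAlgebra
  Literature.NumberTheory.EllipticCurves.IwasawaModuleFinitePadicInt
  NumberField IsDedekindDomain Field
  Summit.BirchSwinnertonDyer.Rank1Residual.X11b Summit.BirchSwinnertonDyer.Rank1Residual.X11b.AcSelmer
  Summit.BirchSwinnertonDyer.BirchSwinnertonDyer.Theorems.UniversalToricDescentAcDualMuZero

namespace Summit.BirchSwinnertonDyer.BirchSwinnertonDyer.Cruxes.TwinAlgMuZeroAtThree.OnePointSqueeze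

/-! ### §0 The character polynomials `Φ_{3^m}(1+T) ∈ Λ = ℤ₃⟦T⟧` -/

/-- `Φ_{3^m}(1+T) = 1 + (1+T)^{3^{m-1}} + (1+T)^{2·3^{m-1}}` (`m ≥ 1`): its zeros in the open disc are the
`ζ − 1`, `ζ` a primitive `3^m`-th root of unity, i.e. the characters of `Γ` of exact order `3^m` (`γ ↦ 1+T`);
`Φ_m ≡ T^{φ(3^m)} (mod 3)`. -/
def cycLayer (m : ℕ) : IwasawaAlgebra 3 :=
  ∑ i ∈ Finset.range 3, (1 + PowerSeries.X) ^ (i * 3 ^ (m - 1))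

/-- The `m`-th CHARACTER LAYER of a `Λ`-module: `X / Φ_{3^m}(γ) X` (for `X = X_ac` this is, up to a bounded control
error, the Pontryagin dual of `⊕_{χ of order 3^m} Sel_{(∅,0)}(K, E′[3^∞] ⊗ χ)`, a module over `ℤ₃[ζ_{3^m}]`). -/
abbrev CharLayer (X : Type) [AddCommGroup X] [Module (IwasawaAlgebra 3) X] (m : ℕ) : Type :=
  X ⧸ (Ideal.span {cycLayer m} • (⊤ : Submodule (IwasawaAlgebra 3) X))

/-! ### §1 Pure `Λ`-algebra: bounded character layers ⟹ torsion ∧ μ = 0 -/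

/-- **Bounded character layers**: `#(X/Φ_m X) ≤ 3^B` for all `m ≥ m₀` (finite, of bounded order). -/
def BoundedCharLayers (X : Type) [AddCommGroup X] [Module (IwasawaAlgebra 3) X] : Prop :=
  ∃ B m₀ : ℕ, ∀ m : ℕ, m₀ ≤ m → Finite (CharLayer X m) ∧ Nat.card (CharLayer X m) ≤ 3 ^ B

/-- **P2 (support, pure algebra; to be PROVED).** For a finitely generated `Λ`-module, bounded character layers force
`X/3X` finite (`Φ_m ≡ T^{φ(3^m)} (mod 3)`, so `#(X/(3,T^n)X)` is bounded along `n = φ(3^m) → ∞`; the chain `TⁿX̄` in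
`X̄ = X/3X` stabilises, Nakayama with `T ∈ rad Λ` kills it, `X̄` is finite).  With the tree this gives `X` finitely
generated over `ℤ₃`, hence `Λ`-torsion with `μ = 0` (Washington §13.2; tree `moduleFinite_padicInt_of_finite_quotient_augIdealP`). -/
def BoundedCharLayersCriterion : Prop :=
  ∀ (X : Type) [AddCommGroup X] [Module (IwasawaAlgebra 3) X] [Module.Finite (IwasawaAlgebra 3) X],
    BoundedCharLayers X → Finite (X ⧸ (augIdealP 3 • (⊤ : Submodule (IwasawaAlgebra 3) X)))

/-- **ENDGAME (PROVED composition on the crux's object).** Bounded character layers of Castella's dual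
`X_ac(E/K_∞)` (any elliptic `W/K`, `Σ = ∅`) give EXACTLY the conclusion shape of `TwinAlgMuZeroAtThree`:
`Λ`-torsion and `Ch_Λ(X)·R₀⟦T⟧ = (g)` with a norm-one coefficient. -/
theorem conclusion_of_boundedCharLayers (hcrit : BoundedCharLayersCriterion)
    {K : Type} [Field K] [NumberField K] (W : WeierstrassCurve K) [W.IsElliptic]
    (κ : ZpExtension K 3) (𝔭 : HeightOneSpectrum (𝓞 K)) (γ : absoluteGaloisGroup K)
    [Fact (κ.IsTopGenerator γ)] (hX : BoundedCharLayers (XAc W 3 κ 𝔭 ∅ γ)) :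
    Module.IsTorsion (IwasawaAlgebra 3) (XAc W 3 κ 𝔭 ∅ γ) ∧
      ∃ g : UnrSeries 3,
        (XAc.charIdeal W 3 κ 𝔭 ∅ γ).map (PowerSeries.map (Halves.toUnr 3)) = Ideal.span {g} ∧
          ∃ i : ℕ, ‖((PowerSeries.coeff i g : unrIntegers 3) : ℂ_[3])‖ = 1 := by
  haveI := XAc.module_finite κ 𝔭 ∅ γ Set.finite_empty (W := W)
  have hfin := hcrit (XAc W 3 κ 𝔭 ∅ γ) hX
  have hfg := moduleFinite_padicInt_of_finite_quotient_augIdealP 3 (XAc W 3 κ 𝔭 ∅ γ) hfin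
  exact isTorsion_and_exists_generator_of_finite_pTorsion W 3 κ 𝔭 ∅ γ Set.finite_empty
    (finite_pTorsion_of_moduleFinite_padicInt W 3 κ 𝔭 ∅ γ hfg)

/-! ### §2 The analytic side read at torsion points -/

/-- **P1 (support; Weierstrass preparation over `R₀ = unrIntegers 3`).** A power series `L ∈ R₀⟦T⟧` with a unit
coefficient (`μ(L) = 0`, Weierstrass degree `λ`) has `‖L(ζ − 1)‖ = ‖ζ − 1‖^λ` at every primitive `3^m`-th root of
unity `ζ` for `m ≫ 0` (the distinguished polynomial dominates: `v(ζ−1) = 1/φ(3^m) < v(c_i)/λ`).  Classical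
(Iwasawa/Washington §7.3–§13.3 style); the converse limit formula `μ(L) = lim_m v₃ L(ζ_{3^m} − 1)` is why the
squeeze loses nothing.  Elementary proof route (no Weierstrass preparation needed): the norm on `R₀ = 𝓞(\widehat{ℚ₃^{ur}})`
is DISCRETE (`‖c‖ < 1 ⇒ ‖c‖ ≤ 3⁻¹`); with `λ` the least index of a unit coefficient and `ρ = ‖ζ − 1‖ = 3^{-1/φ(3^m)}`,
the term `c_λ (ζ−1)^λ` has norm `ρ^λ`, every earlier term has norm `≤ 3⁻¹ < ρ^λ` once `φ(3^m) > λ`, every later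
term has norm `≤ ρ^{λ+1} < ρ^λ`; the ultrametric inequality gives `‖L(ζ−1)‖ = ρ^λ`.  Only the LOWER bound
`‖L(ζ−1)‖ ≥ ρ^λ` is used by the squeeze. -/
def UnitCoeffValuesAtTorsionPoints : Prop :=
  ∀ L : UnrSeries 3, (∃ i : ℕ, ‖((PowerSeries.coeff i L : unrIntegers 3) : ℂ_[3])‖ = 1) →
    ∃ lam m₀ : ℕ, ∀ m : ℕ, m₀ ≤ m → ∀ ζ : ℂ_[3], IsPrimitiveRoot ζ (3 ^ m) →
      ∀ v : ℂ_[3], L.HasValueAt (ζ - 1) v → ‖v‖ = ‖ζ - 1‖ ^ lam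

/-- **P0 (support, folklore local fact).** For a primitive `3^m`-th root of unity `ζ ∈ ℂ₃` (`m ≥ 1`),
`‖ζ − 1‖^{φ(3^m)} = ‖3‖ = 3⁻¹` (`∏_{a ∈ (ℤ/3^m)ˣ} (1 − ζ^a) = Φ_{3^m}(1) = 3`, all factors of equal norm). -/
def PrimitiveRootNormAtThree : Prop :=
  ∀ m : ℕ, 1 ≤ m → ∀ ζ : ℂ_[3], IsPrimitiveRoot ζ (3 ^ m) →
    ‖ζ - 1‖ ^ Nat.totient (3 ^ m) = (3 : ℝ)⁻¹

/-! ### §3 The arithmetic input: ONE finite-level inequality per character (the card's `C⁺`) -/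

/-- **K1 = C⁺ (crux of the line, rank 2): TWISTED ONE-POINT KOLYVAGIN INEQUALITY AT 3.**  Binders = those of
`TwinAlgMuZeroAtThree` (bucket guard B/C₀, mod-3 surjectivity, Heegner `K` of odd discriminant, `3 = 𝔭𝔭′`) plus a
BDP frame `L′` of `f_{E′}` at `(ι′, 𝔭)` (as in `TwinMuZeroAtThree` / `TwinWanFrameAtThreeGoodSSApZero`).  Conclusion:
there are `B, m₀` such that for every `m ≥ m₀` and every primitive `3^m`-th root of unity `ζ` (= character `χ` of `Γ`
of order `3^m`, `χ(γ) = ζ`) AT WHICH `L′(ζ − 1) ≠ 0` (non-torsion twisted Heegner class — the honest Kolyvagin guard;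
the squeeze supplies non-vanishing for `m ≫ 0` from the analytic `μ = 0` via P1), the character layer `X′/Φ_m X′` of
`X′ = X_ac(E′/K_∞)` strict at `𝔭′` is finite and `#(X′/Φ_m X′) · ‖L′(ζ − 1)‖^{φ(3^m)} ≤ 3^B`.
Informal proof plan (stubs of the line): (S1) control at `χ`: `X′/Φ_m X′ ≃ (⊕_{ord χ = 3^m} Sel_{(∅,0)}(K, A′_χ))^∨` up
to `O(1)`; (S2) finite-level Poitou–Tate: `ℓ(Sel_{(∅,0)}(K,A′_χ)^∨) ≤ ℓ(Ш_BK(K,A′_χ)) + 2·[locind_{𝔭′}(z_χ) − ind(z_χ)] + O(1)`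
(`c` swaps `χ ↔ χ̄` and `𝔭 ↔ 𝔭′`, so the two local indices agree); (S3) `χ`-twisted Heegner–Kolyvagin over `K` for
`T_χ = T₃E′ ⊗ O_χ(χ)`: `ℓ(Ш_BK(K,A′_χ)) ≤ 2·ind(z_χ) + O(1)` UNIFORMLY in `m` — the global index cancels against (S2);
(S4) `p`-adic Waldspurger at the ramified finite-order `χ`: `L′(χ̄)·(local resolvent factor) = unit·(log_{ω} z_χ)²`, i.e.
`2·locind_{𝔭′}(z_χ) = v_π(L′(ζ−1)) + O(1)`.  All `O(1)` are `O_χ`-lengths of `χ`-twisted coinvariants of FIXED finite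
modules (Tamagawa, torsion, control), hence bounded independently of `m` (they are killed by `ζ_w − 1`, `v_π(ζ_w − 1) = 3^{a_w}`).
Why it might fail: the `p = 3` Kolyvagin hypotheses (a unipotent generator in `ρ_{E′,3^∞}(G_{K_∞(μ_{3^∞})})` is automatic
only for full 3-adic image; mod-3 surjectivity alone leaves the Elkies-type index-3/27 images to check) and the ramified-`χ`
Waldspurger formula at `3 ∥ N′` (bucket B) are ports, not print. -/
def TwistedOnePointKolyvaginAtThree : Prop :=
  ∀ (W' : WeierstrassCurve ℚ) [W'.IsElliptic] [W'.IsGloballyMinimal] (N' : ℕ) [NeZero N'] (K : Type) [Field K]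
    [NumberField K] (Dt' : Literature.NumberTheory.EllipticCurves.ModularForms.ModularParametrizationData W' N'),
    (Literature.NumberTheory.EllipticCurves.Rank1Residual.Mult W' 3 ∧ ¬ 3 ∣ padicValInt 3 W'.minimalDiscriminantInt ∨
      Literature.NumberTheory.EllipticCurves.Rank1Residual.GoodSS W' 3 ∧ W'.frobeniusTrace 3 = 0) →
    W'.HasSurjectiveModNGaloisRep 3 → W'.conductorNorm ℤ = N' →
    Literature.NumberTheory.EllipticCurves.IsImaginaryQuadratic K →
    Literature.NumberTheory.EllipticCurves.SatisfiesHeegnerHypothesis N' K → Odd (NumberField.discr K) →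
    ∀ (κ : Literature.NumberTheory.EllipticCurves.ZpExtension K 3), κ.IsAnticyclotomic →
    ∀ (γ : Field.absoluteGaloisGroup K) [Fact (κ.IsTopGenerator γ)]
      (𝔭 : IsDedekindDomain.HeightOneSpectrum (NumberField.RingOfIntegers K)),
      ((3 : ℕ) : NumberField.RingOfIntegers K) ∈ 𝔭.asIdeal →
      𝔭.asIdeal.ramificationIdx (NumberField.RingOfIntegers ℚ) = 1 →
      𝔭.asIdeal.inertiaDeg (NumberField.RingOfIntegers ℚ) = 1 →
    ∀ (𝔭' : IsDedekindDomain.HeightOneSpectrum (NumberField.RingOfIntegers K)),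
      ((3 : ℕ) : NumberField.RingOfIntegers K) ∈ 𝔭'.asIdeal → 𝔭' ≠ 𝔭 →
    ∀ (ι' : PadicAlgCl 3 ≃+* ℂ),
      Summit.BirchSwinnertonDyer.BirchSwinnertonDyer.Theorems.SchneiderFree.BranchInducesPrime 3 ι' 𝔭 →
    ∀ (ΩK : ℂ) (Ωp : ℂ_[3]) (L' : Literature.NumberTheory.EllipticCurves.UnrSeries 3), ΩK ≠ 0 → Ωp ≠ 0 →
      Literature.NumberTheory.EllipticCurves.IsBDPLFunction ι' 𝔭 κ γ Dt'.f ΩK Ωp L' →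
    ∃ B m₀ : ℕ, ∀ m : ℕ, m₀ ≤ m → ∀ ζ : ℂ_[3], IsPrimitiveRoot ζ (3 ^ m) → ∀ v : ℂ_[3], L'.HasValueAt (ζ - 1) v →
      v ≠ 0 →
      Finite (CharLayer (Summit.BirchSwinnertonDyer.Rank1Residual.X11b.AcSelmer.XAc (W'.baseChange K) 3 κ 𝔭' ∅ γ) m) ∧
        (Nat.card (CharLayer (Summit.BirchSwinnertonDyer.Rank1Residual.X11b.AcSelmer.XAc (W'.baseChange K) 3 κ 𝔭' ∅ γ) m) : ℝ)
          * ‖v‖ ^ Nat.totient (3 ^ m) ≤ (3 : ℝ) ^ B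

/-! ### §4 The squeeze: exponent bookkeeping (PROVED) -/

/-- **One character, one inequality (PROVED).** If `#(X/Φ_m X)·‖v‖^{φ(3^m)} ≤ 3^B`, `‖v‖ = ‖ζ−1‖^λ` and
`‖ζ−1‖^{φ(3^m)} = ‖3‖ = 3⁻¹`, then `#(X/Φ_m X) ≤ 3^{B+λ}`. -/
theorem card_le_of_onePoint {c B lam φ : ℕ} {nv nz : ℝ}
    (hineq : (c : ℝ) * nv ^ φ ≤ (3 : ℝ) ^ B) (hv : nv = nz ^ lam) (hz : nz ^ φ = (3 : ℝ)⁻¹) :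
    c ≤ 3 ^ (B + lam) := by
  have h3 : (0 : ℝ) < 3 := by norm_num
  have hpow : nv ^ φ = ((3 : ℝ) ^ lam)⁻¹ := by
    rw [hv, ← pow_mul, mul_comm, pow_mul, hz, inv_pow]
  rw [hpow] at hineq
  have hlam : (0 : ℝ) < (3 : ℝ) ^ lam := pow_pos h3 lam
  have : (c : ℝ) ≤ (3 : ℝ) ^ B * (3 : ℝ) ^ lam := by
    have := mul_le_mul_of_nonneg_right hineq hlam.le
    rwa [mul_assoc, inv_mul_cancel₀ hlam.ne', mul_one] at this
  rw [← pow_add] at this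
  exact_mod_cast this

/-- **THE SQUEEZE (PROVED modulo the four named Props): `C⁺` + analytic `μ = 0` (frame-wise) ⟹ bounded character
layers of `X′`, for every datum of `TwinAlgMuZeroAtThree` that carries a BDP frame `L′` with a unit coefficient.**
Combined with `conclusion_of_boundedCharLayers` this is the crux's conclusion for that datum. -/
theorem boundedCharLayers_of_squeeze (hK : TwistedOnePointKolyvaginAtThree) (hP1 : UnitCoeffValuesAtTorsionPoints)
    (hP0 : PrimitiveRootNormAtThree)
    (hroots : ∀ m : ℕ, 1 ≤ m → ∃ ζ : ℂ_[3], IsPrimitiveRoot ζ (3 ^ m))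
    (hval : ∀ (L : UnrSeries 3) (m : ℕ), 1 ≤ m → ∀ ζ : ℂ_[3], IsPrimitiveRoot ζ (3 ^ m) → ∃ v, L.HasValueAt (ζ - 1) v)
    (W' : WeierstrassCurve ℚ) [W'.IsElliptic] [W'.IsGloballyMinimal] (N' : ℕ) [NeZero N'] (K : Type) [Field K]
    [NumberField K] (Dt' : Literature.NumberTheory.EllipticCurves.ModularForms.ModularParametrizationData W' N')
    (hbucket : Literature.NumberTheory.EllipticCurves.Rank1Residual.Mult W' 3 ∧
        ¬ 3 ∣ padicValInt 3 W'.minimalDiscriminantInt ∨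
      Literature.NumberTheory.EllipticCurves.Rank1Residual.GoodSS W' 3 ∧ W'.frobeniusTrace 3 = 0)
    (hsurj : W'.HasSurjectiveModNGaloisRep 3) (hN : W'.conductorNorm ℤ = N')
    (hK' : Literature.NumberTheory.EllipticCurves.IsImaginaryQuadratic K)
    (hH : Literature.NumberTheory.EllipticCurves.SatisfiesHeegnerHypothesis N' K) (hodd : Odd (NumberField.discr K))
    (κ : Literature.NumberTheory.EllipticCurves.ZpExtension K 3) (hκ : κ.IsAnticyclotomic)
    (γ : Field.absoluteGaloisGroup K) [Fact (κ.IsTopGenerator γ)]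
    (𝔭 : IsDedekindDomain.HeightOneSpectrum (NumberField.RingOfIntegers K))
    (h𝔭 : ((3 : ℕ) : NumberField.RingOfIntegers K) ∈ 𝔭.asIdeal)
    (he : 𝔭.asIdeal.ramificationIdx (NumberField.RingOfIntegers ℚ) = 1)
    (hf : 𝔭.asIdeal.inertiaDeg (NumberField.RingOfIntegers ℚ) = 1)
    (𝔭' : IsDedekindDomain.HeightOneSpectrum (NumberField.RingOfIntegers K))
    (h𝔭' : ((3 : ℕ) : NumberField.RingOfIntegers K) ∈ 𝔭'.asIdeal) (hne : 𝔭' ≠ 𝔭)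
    (ι' : PadicAlgCl 3 ≃+* ℂ)
    (hι : Summit.BirchSwinnertonDyer.BirchSwinnertonDyer.Theorems.SchneiderFree.BranchInducesPrime 3 ι' 𝔭)
    (ΩK : ℂ) (Ωp : ℂ_[3]) (L' : Literature.NumberTheory.EllipticCurves.UnrSeries 3) (hΩK : ΩK ≠ 0) (hΩp : Ωp ≠ 0)
    (hL : Literature.NumberTheory.EllipticCurves.IsBDPLFunction ι' 𝔭 κ γ Dt'.f ΩK Ωp L')
    (hμ : ∃ i : ℕ, ‖((PowerSeries.coeff i L' : unrIntegers 3) : ℂ_[3])‖ = 1) :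
    BoundedCharLayers (Summit.BirchSwinnertonDyer.Rank1Residual.X11b.AcSelmer.XAc (W'.baseChange K) 3 κ 𝔭' ∅ γ) := by
  obtain ⟨B, m₀, hB⟩ := hK W' N' K Dt' hbucket hsurj hN hK' hH hodd κ hκ γ 𝔭 h𝔭 he hf 𝔭' h𝔭' hne ι' hι ΩK Ωp L'
    hΩK hΩp hL
  obtain ⟨lam, m₁, hlam⟩ := hP1 L' hμ
  refine ⟨B + lam, max (max m₀ m₁) 1, fun m hm ↦ ?_⟩
  have hm₀ : m₀ ≤ m := le_trans (le_trans (le_max_left _ _) (le_max_left _ _)) hm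
  have hm₁ : m₁ ≤ m := le_trans (le_trans (le_max_right _ _) (le_max_left _ _)) hm
  have hm1 : 1 ≤ m := le_trans (le_max_right _ _) hm
  obtain ⟨ζ, hζ⟩ := hroots m hm1
  obtain ⟨v, hv⟩ := hval L' m hm1 ζ hζ
  have hvne : v ≠ 0 := by
    intro h0
    have hn := hlam m hm₁ ζ hζ v hv
    rw [h0, norm_zero] at hn
    have hz : ‖ζ - 1‖ ≠ 0 := by
      intro hz
      have h3 := hP0 m hm1 ζ hζ
      rw [hz, zero_pow (Nat.totient_pos.2 (pow_pos (by norm_num) m)).ne'] at h3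
      norm_num at h3
    exact (pow_ne_zero lam hz) hn.symm
  obtain ⟨hfin, hineq⟩ := hB m hm₀ ζ hζ v hv hvne
  exact ⟨hfin, card_le_of_onePoint hineq (hlam m hm₁ ζ hζ v hv) (hP0 m hm1 ζ hζ)⟩

/-! ### §5 P2 PROVED: bounded character layers ⟹ `X/3X` finite (Nakayama over `Λ/3 = 𝔽₃⟦T⟧`) -/

/-- `Φ_{3^m}(1+T) ≡ T^{2·3^{m-1}} (mod 3)` in `Λ` (`m ≥ 1`). -/
theorem cycLayer_eq_X_pow_add (m : ℕ) (hm : 1 ≤ m) :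
    ∃ u : IwasawaAlgebra 3, cycLayer m = PowerSeries.X ^ (2 * 3 ^ (m - 1)) + 3 * u := by
  have h3 : Nat.Prime 3 := Nat.prime_three
  obtain ⟨r, hr⟩ : ∃ r : IwasawaAlgebra 3,
      (1 + PowerSeries.X) ^ 3 ^ (m - 1) = 1 + PowerSeries.X ^ 3 ^ (m - 1) + 3 * r := by
    refine ⟨1 * PowerSeries.X * ∑ k ∈ Finset.Ioo 0 (3 ^ (m - 1)),
      (1 : IwasawaAlgebra 3) ^ (k - 1) * PowerSeries.X ^ (3 ^ (m - 1) - k - 1) *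
        (((3 ^ (m - 1)).choose k / 3 : ℕ) : IwasawaAlgebra 3), ?_⟩
    have := add_pow_prime_pow_eq h3 (1 : IwasawaAlgebra 3) PowerSeries.X (m - 1)
    rw [this, one_pow]
    push_cast
    ring
  refine ⟨1 + PowerSeries.X ^ 3 ^ (m - 1) + 3 * r + 3 * r ^ 2 + 2 * PowerSeries.X ^ 3 ^ (m - 1) * r, ?_⟩
  unfold cycLayer
  simp only [Finset.sum_range_succ, Finset.sum_range_zero, zero_mul, pow_zero, one_mul, zero_add]
  rw [show 2 * 3 ^ (m - 1) = 3 ^ (m - 1) * 2 from by ring, pow_mul, pow_mul, hr]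
  ring

/-- The ideals `(T^n, 3) ⊂ Λ`. -/
def layerIdeal (n : ℕ) : Ideal (IwasawaAlgebra 3) := Ideal.span {PowerSeries.X ^ n, 3}

theorem span_cycLayer_le (m : ℕ) (hm : 1 ≤ m) :
    Ideal.span {cycLayer m} ≤ layerIdeal (2 * 3 ^ (m - 1)) := by
  obtain ⟨u, hu⟩ := cycLayer_eq_X_pow_add m hm
  rw [Ideal.span_singleton_le_iff_mem, hu]
  exact Ideal.add_mem _ (Ideal.subset_span (by simp))
    (Ideal.mul_mem_right _ _ (Ideal.subset_span (by simp [layerIdeal])))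

theorem layerIdeal_anti {n N : ℕ} (h : n ≤ N) : layerIdeal N ≤ layerIdeal n := by
  unfold layerIdeal
  rw [Ideal.span_le]
  rintro x hx
  simp only [Set.mem_insert_iff, Set.mem_singleton_iff] at hx
  rcases hx with rfl | rfl
  · rw [show N = (N - n) + n from (Nat.sub_add_cancel h).symm, pow_add]
    exact Ideal.mul_mem_left _ _ (Ideal.subset_span (by simp))
  · exact Ideal.subset_span (by simp)

theorem three_mem_layerIdeal (n : ℕ) : (3 : IwasawaAlgebra 3) ∈ layerIdeal n :=
  Ideal.subset_span (by simp [layerIdeal])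

theorem X_pow_mem_layerIdeal (n : ℕ) : (PowerSeries.X ^ n : IwasawaAlgebra 3) ∈ layerIdeal n :=
  Ideal.subset_span (by simp [layerIdeal])

section ModuleGeneric

variable {A : Type*} [CommRing A] {X : Type*} [AddCommGroup X] [Module A X]

theorem finite_quot_of_le {I J : Ideal A} (h : I ≤ J) (hf : Finite (X ⧸ (I • (⊤ : Submodule A X)))) :
    Finite (X ⧸ (J • (⊤ : Submodule A X))) ∧
      Nat.card (X ⧸ (J • (⊤ : Submodule A X))) ≤ Nat.card (X ⧸ (I • (⊤ : Submodule A X))) := by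
  have hle : I • (⊤ : Submodule A X) ≤ J • ⊤ := Submodule.smul_mono_left h
  haveI := hf
  exact ⟨Finite.of_surjective _ (Submodule.factor_surjective hle),
    Nat.card_le_card_of_surjective _ (Submodule.factor_surjective hle)⟩

/-- Equal finite cardinalities of nested quotients force equality of the submodules. -/
theorem le_of_card_quot_le {p p' : Submodule A X} (h : p ≤ p') [Finite (X ⧸ p)]
    (hc : Nat.card (X ⧸ p) ≤ Nat.card (X ⧸ p')) : p' ≤ p := by
  have hbij := (Submodule.factor_surjective h).bijective_of_nat_card_le hc
  intro x hx
  have h0 : Submodule.factor h (Submodule.Quotient.mk x) = 0 := by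
    change Submodule.mapQ p p' LinearMap.id h (Submodule.Quotient.mk x) = 0
    rw [Submodule.mapQ_apply, LinearMap.id_apply]
    exact (Submodule.Quotient.mk_eq_zero p').2 hx
  have := hbij.1 (h0.trans (map_zero _).symm)
  exact (Submodule.Quotient.mk_eq_zero p).1 this

/-- Membership in `(a, b) • ⊤`. -/
theorem mem_span_pair_smul_top {a b : A} {x : X} (hx : x ∈ Ideal.span {a, b} • (⊤ : Submodule A X)) :
    ∃ w w' : X, x = a • w + b • w' := by
  have hsplit : Ideal.span ({a, b} : Set A) = Ideal.span {a} ⊔ Ideal.span {b} := by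
    rw [Set.insert_eq, Ideal.span_union]
  rw [hsplit, Submodule.sup_smul, Submodule.mem_sup] at hx
  obtain ⟨y, hy, z, hz, rfl⟩ := hx
  rw [Submodule.ideal_span_singleton_smul, Submodule.mem_smul_pointwise_iff_exists] at hy hz
  obtain ⟨w, -, rfl⟩ := hy
  obtain ⟨w', -, rfl⟩ := hz
  exact ⟨w, w', rfl⟩

end ModuleGeneric

theorem exists_succ_le_of_bounded (f : ℕ → ℕ) (B : ℕ) (hB : ∀ n, f n ≤ B) : ∃ n, f (n + 1) ≤ f n := by
  by_contra h
  push_neg at h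
  have key : ∀ n, n ≤ f n := by
    intro n
    induction n with
    | zero => exact Nat.zero_le _
    | succ k ih => exact Nat.succ_le_of_lt (lt_of_le_of_lt ih (h k))
  have := key (B + 1)
  have := hB (B + 1)
  omega

theorem X_not_isUnit : ¬ IsUnit (PowerSeries.X : IwasawaAlgebra 3) := by
  intro h
  have h0 := h.map (PowerSeries.constantCoeff (R := ℤ_[3]))
  rw [PowerSeries.constantCoeff_X, isUnit_zero_iff] at h0
  exact zero_ne_one h0

theorem span_X_le_jacobson_bot :
    Ideal.span {(PowerSeries.X : IwasawaAlgebra 3)} ≤ (⊥ : Ideal (IwasawaAlgebra 3)).jacobson := by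
  refine le_trans ?_ (IsLocalRing.maximalIdeal_le_jacobson ⊥)
  rw [Ideal.span_singleton_le_iff_mem]
  exact (IsLocalRing.mem_maximalIdeal _).2 X_not_isUnit

/-- **P2 PROVED.** -/
theorem boundedCharLayersCriterion_holds : BoundedCharLayersCriterion := by
  intro X _ _ _ hX
  obtain ⟨B, m₀, hB⟩ := hX
  -- every `(T^n, 3)`-layer is finite of order ≤ 3^B
  have hQ : ∀ n : ℕ, Finite (X ⧸ (layerIdeal n • (⊤ : Submodule (IwasawaAlgebra 3) X))) ∧
      Nat.card (X ⧸ (layerIdeal n • (⊤ : Submodule (IwasawaAlgebra 3) X))) ≤ 3 ^ B := by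
    intro n
    have hm₀ : m₀ ≤ max m₀ (n + 1) := le_max_left _ _
    have hm1 : 1 ≤ max m₀ (n + 1) := le_trans (by omega) (le_max_right _ _)
    have hnN : n ≤ 2 * 3 ^ (max m₀ (n + 1) - 1) := by
      have h1 : max m₀ (n + 1) - 1 < 3 ^ (max m₀ (n + 1) - 1) := Nat.lt_pow_self (by norm_num)
      have h2 : n + 1 ≤ max m₀ (n + 1) := le_max_right _ _
      omega
    obtain ⟨hfin, hcard⟩ := hB (max m₀ (n + 1)) hm₀
    have hle : Ideal.span {cycLayer (max m₀ (n + 1))} ≤ layerIdeal n :=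
      (span_cycLayer_le _ hm1).trans (layerIdeal_anti hnN)
    obtain ⟨hf, hc⟩ := finite_quot_of_le (X := X) hle hfin
    exact ⟨hf, hc.trans hcard⟩
  -- the orders stabilise: `(T^n,3)X = (T^{n+1},3)X` for some `n`
  obtain ⟨n, hn⟩ := exists_succ_le_of_bounded
    (fun n => Nat.card (X ⧸ (layerIdeal n • (⊤ : Submodule (IwasawaAlgebra 3) X)))) (3 ^ B) (fun n => (hQ n).2)
  have hle : layerIdeal (n + 1) • (⊤ : Submodule (IwasawaAlgebra 3) X) ≤ layerIdeal n • ⊤ :=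
    Submodule.smul_mono_left (layerIdeal_anti (Nat.le_succ n))
  haveI := (hQ (n + 1)).1
  have hge : layerIdeal n • (⊤ : Submodule (IwasawaAlgebra 3) X) ≤ layerIdeal (n + 1) • ⊤ :=
    le_of_card_quot_le hle hn
  -- Nakayama in `Y = X/3X` for `N = T^n Y`
  set P3 : Submodule (IwasawaAlgebra 3) X := Ideal.span {(3 : IwasawaAlgebra 3)} • ⊤ with hP3
  set N : Submodule (IwasawaAlgebra 3) (X ⧸ P3) :=
    Ideal.span {(PowerSeries.X ^ n : IwasawaAlgebra 3)} • ⊤ with hN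
  have hXn : ∀ x : X, ∃ w w' : X, (PowerSeries.X ^ n : IwasawaAlgebra 3) • x =
      (PowerSeries.X ^ (n + 1) : IwasawaAlgebra 3) • w + (3 : IwasawaAlgebra 3) • w' := by
    intro x
    have hx : (PowerSeries.X ^ n : IwasawaAlgebra 3) • x ∈ layerIdeal (n + 1) • (⊤ : Submodule _ X) :=
      hge (Submodule.smul_mem_smul (X_pow_mem_layerIdeal n) Submodule.mem_top)
    exact mem_span_pair_smul_top hx
  have hNle : N ≤ Ideal.span {(PowerSeries.X : IwasawaAlgebra 3)} • N := by
    rw [hN, Submodule.smul_le]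
    intro r hr y _
    obtain ⟨a, rfl⟩ := Ideal.mem_span_singleton'.1 hr
    rw [mul_smul]
    refine Submodule.smul_mem _ a ?_
    induction y using Submodule.Quotient.induction_on with
    | H x =>
      obtain ⟨w, w', hw⟩ := hXn x
      rw [← Submodule.Quotient.mk_smul, hw, Submodule.Quotient.mk_add, Submodule.Quotient.mk_smul,
        Submodule.Quotient.mk_smul]
      have h3w : (Submodule.Quotient.mk ((3 : IwasawaAlgebra 3) • w') : X ⧸ P3) = 0 := by
        rw [Submodule.Quotient.mk_eq_zero, hP3]
        exact Submodule.smul_mem_smul (Ideal.subset_span rfl) Submodule.mem_top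
      rw [Submodule.Quotient.mk_smul] at h3w
      rw [h3w, add_zero, pow_succ, mul_comm, mul_smul]
      exact Submodule.smul_mem_smul (Ideal.subset_span rfl)
        (Submodule.smul_mem_smul (Ideal.subset_span rfl) Submodule.mem_top)
  have hNfg : N.FG := by
    haveI : IsNoetherian (IwasawaAlgebra 3) (X ⧸ P3) := isNoetherian_of_isNoetherianRing_of_finite _ _
    exact IsNoetherian.noetherian N
  have hN0 : N = ⊥ := Submodule.eq_bot_of_le_smul_of_le_jacobson_bot _ N hNfg hNle span_X_le_jacobson_bot
  -- hence `T^n X ⊆ 3X`, so `(T^n,3)X = 3X` and `X/3X` is the finite layer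
  have hXn3 : ∀ x : X, (PowerSeries.X ^ n : IwasawaAlgebra 3) • x ∈ P3 := by
    intro x
    have : (Submodule.Quotient.mk ((PowerSeries.X ^ n : IwasawaAlgebra 3) • x) : X ⧸ P3) ∈ N := by
      rw [Submodule.Quotient.mk_smul, hN]
      exact Submodule.smul_mem_smul (Ideal.subset_span rfl) Submodule.mem_top
    rw [hN0, Submodule.mem_bot] at this
    exact (Submodule.Quotient.mk_eq_zero P3).1 this
  have hEq : layerIdeal n • (⊤ : Submodule (IwasawaAlgebra 3) X) = P3 := by
    apply le_antisymm
    · rw [Submodule.smul_le]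
      intro r hr x _
      obtain ⟨a, b, rfl⟩ := Ideal.mem_span_pair.1 hr
      rw [add_smul, mul_smul, mul_smul]
      exact P3.add_mem (P3.smul_mem a (hXn3 x))
        (P3.smul_mem b (Submodule.smul_mem_smul (Ideal.subset_span rfl) Submodule.mem_top))
    · exact Submodule.smul_mono_left
        ((Ideal.span_singleton_le_iff_mem _).2 (three_mem_layerIdeal n))
  have hC : (PowerSeries.C ((3 : ℕ) : ℤ_[3]) : IwasawaAlgebra 3) = 3 := by
    rw [map_natCast, Nat.cast_ofNat]
  change Finite (X ⧸ (Ideal.span {PowerSeries.C ((3 : ℕ) : ℤ_[3])} • (⊤ : Submodule (IwasawaAlgebra 3) X)))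
  rw [hC, ← hP3, ← hEq]
  exact (hQ n).1

/-- **COROLLARY (PROVED): the endgame is unconditional in P2.** -/
theorem conclusion_of_boundedCharLayers' {K : Type} [Field K] [NumberField K] (W : WeierstrassCurve K)
    [W.IsElliptic] (κ : ZpExtension K 3) (𝔭 : HeightOneSpectrum (𝓞 K)) (γ : absoluteGaloisGroup K)
    [Fact (κ.IsTopGenerator γ)] (hX : BoundedCharLayers (XAc W 3 κ 𝔭 ∅ γ)) :
    Module.IsTorsion (IwasawaAlgebra 3) (XAc W 3 κ 𝔭 ∅ γ) ∧
      ∃ g : UnrSeries 3,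
        (XAc.charIdeal W 3 κ 𝔭 ∅ γ).map (PowerSeries.map (Halves.toUnr 3)) = Ideal.span {g} ∧
          ∃ i : ℕ, ‖((PowerSeries.coeff i g : unrIntegers 3) : ℂ_[3])‖ = 1 :=
  conclusion_of_boundedCharLayers boundedCharLayersCriterion_holds W κ 𝔭 γ hX

/-! ### §6 P0 PROVED and the two existence side conditions of the squeeze discharged -/

theorem norm_three_padicComplex : ‖((3 : ℕ) : ℂ_[3])‖ = (3 : ℝ)⁻¹ := by
  rw [← PadicComplex.coe_natCast, PadicComplex.norm_extends,
    ← map_natCast (algebraMap ℚ_[3] (PadicAlgCl 3)), PadicAlgCl.norm_extends, Padic.norm_p]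
  norm_num

theorem norm_eq_one_of_isPrimitiveRoot {m : ℕ} {ζ : ℂ_[3]} (hζ : IsPrimitiveRoot ζ (3 ^ m)) : ‖ζ‖ = 1 := by
  have h := congrArg norm hζ.pow_eq_one
  rw [norm_pow, norm_one] at h
  exact (pow_eq_one_iff_of_nonneg (norm_nonneg ζ) (pow_ne_zero m (by norm_num))).1 h

theorem norm_pow_sub_one_le {ζ : ℂ_[3]} (hζ : ‖ζ‖ = 1) (a : ℕ) : ‖ζ ^ a - 1‖ ≤ ‖ζ - 1‖ := by
  rw [← geom_sum_mul, norm_mul]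
  have h1 : ‖∑ i ∈ Finset.range a, ζ ^ i‖ ≤ 1 :=
    IsUltrametricDist.norm_sum_le_of_forall_le_of_nonneg zero_le_one
      (fun i _ => by rw [norm_pow, hζ, one_pow])
  calc ‖∑ i ∈ Finset.range a, ζ ^ i‖ * ‖ζ - 1‖ ≤ 1 * ‖ζ - 1‖ := by gcongr
    _ = ‖ζ - 1‖ := one_mul _

/-- All primitive `3^m`-th roots of unity are equidistant from `1` (elementary: `(ζ^a − 1)/(ζ − 1)` is integral). -/
theorem norm_sub_one_eq_of_isPrimitiveRoot {m : ℕ} {ζ μ : ℂ_[3]} (hζ : IsPrimitiveRoot ζ (3 ^ m))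
    (hμ : IsPrimitiveRoot μ (3 ^ m)) : ‖μ - 1‖ = ‖ζ - 1‖ := by
  haveI : NeZero (3 ^ m) := ⟨pow_ne_zero m (by norm_num)⟩
  obtain ⟨a, -, rfl⟩ := hζ.eq_pow_of_pow_eq_one hμ.pow_eq_one
  apply le_antisymm (norm_pow_sub_one_le (norm_eq_one_of_isPrimitiveRoot hζ) a)
  obtain ⟨b, -, hb⟩ := hμ.eq_pow_of_pow_eq_one hζ.pow_eq_one
  calc ‖ζ - 1‖ = ‖(ζ ^ a) ^ b - 1‖ := by rw [hb]
    _ ≤ ‖ζ ^ a - 1‖ := norm_pow_sub_one_le (norm_eq_one_of_isPrimitiveRoot hμ) b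

/-- **P0 PROVED**: `‖ζ − 1‖^{φ(3^m)} = 3⁻¹` (`∏_{μ primitive} (1 − μ) = Φ_{3^m}(1) = 3`). -/
theorem primitiveRootNormAtThree_holds : PrimitiveRootNormAtThree := by
  intro m hm ζ hζ
  obtain ⟨k, rfl⟩ : ∃ k, m = k + 1 := ⟨m - 1, by omega⟩
  have hprod := Polynomial.eval_one_cyclotomic_prime_pow (R := ℂ_[3]) (p := 3) k
  rw [Polynomial.cyclotomic_eq_prod_X_sub_primitiveRoots hζ, Polynomial.eval_prod] at hprod
  simp only [Polynomial.eval_sub, Polynomial.eval_X, Polynomial.eval_C] at hprod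
  have hnorm := congrArg norm hprod
  have hpos : 0 < 3 ^ (k + 1) := pow_pos (by norm_num) _
  rw [norm_prod, Finset.prod_congr rfl (fun μ hμ => by
      rw [norm_sub_rev, norm_sub_one_eq_of_isPrimitiveRoot hζ ((mem_primitiveRoots hpos).1 hμ)]),
    Finset.prod_const, hζ.card_primitiveRoots, norm_three_padicComplex] at hnorm
  exact hnorm

/-- Primitive `3^m`-th roots of unity exist in `ℂ₃` (via the algebraic closure `PadicAlgCl 3`). -/
theorem exists_isPrimitiveRoot_padicComplex (m : ℕ) : ∃ ζ : ℂ_[3], IsPrimitiveRoot ζ (3 ^ m) := by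
  have hpos : 0 < 3 ^ m := pow_pos (by norm_num) m
  haveI : NeZero (3 ^ m) := ⟨hpos.ne'⟩
  have hdeg : (Polynomial.cyclotomic (3 ^ m) (PadicAlgCl 3)).degree ≠ 0 := by
    rw [Polynomial.degree_cyclotomic]
    exact_mod_cast (Nat.totient_pos.2 hpos).ne'
  obtain ⟨μ, hμ⟩ := IsAlgClosed.exists_root _ hdeg
  rw [Polynomial.isRoot_cyclotomic_iff] at hμ
  exact ⟨(μ : ℂ_[3]), hμ.map_of_injective
    (f := (UniformSpace.Completion.coeRingHom : PadicAlgCl 3 →+* ℂ_[3]))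
    (UniformSpace.Completion.coeRingHom : PadicAlgCl 3 →+* ℂ_[3]).injective⟩

/-- The closed unit ball of `ℂ₃` as a subring (ultrametric inequality). -/
def unitBallSubring : Subring ℂ_[3] where
  carrier := {x | ‖x‖ ≤ 1}
  mul_mem' {a b} ha hb := by
    simp only [Set.mem_setOf_eq] at *
    rw [norm_mul]; exact mul_le_one₀ ha (norm_nonneg _) hb
  one_mem' := by simp
  add_mem' {a b} ha hb := by
    simp only [Set.mem_setOf_eq] at *
    exact (IsUltrametricDist.norm_add_le_max a b).trans (max_le ha hb)
  zero_mem' := by simp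
  neg_mem' {a} ha := by simpa using ha

/-- `R₀ ⊂ 𝓞_{ℂ₃}`: every element of `unrIntegers 3` has norm `≤ 1`. -/
theorem norm_le_one_of_mem_unrIntegers {c : ℂ_[3]} (hc : c ∈ unrIntegers 3) : ‖c‖ ≤ 1 := by
  have hcl : Subring.closure {ζ : ℂ_[3] | ∃ m : ℕ, 0 < m ∧ ¬ 3 ∣ m ∧ ζ ^ m = 1} ≤ unitBallSubring := by
    rw [Subring.closure_le]
    rintro ζ ⟨m, hm, -, hζ⟩
    have h := congrArg norm hζ
    rw [norm_pow, norm_one] at h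
    show ‖ζ‖ ≤ 1
    exact ((pow_eq_one_iff_of_nonneg (norm_nonneg ζ) hm.ne').1 h).le
  have hclosed : IsClosed (unitBallSubring : Set ℂ_[3]) := by
    show IsClosed {x : ℂ_[3] | ‖x‖ ≤ 1}
    exact isClosed_le continuous_norm continuous_const
  exact (Subring.topologicalClosure_minimal _ hcl hclosed) hc

/-- `HasValueAt` is total on the open unit disc: the series converges (geometric majorant). -/
theorem exists_hasValueAt (L : UnrSeries 3) {x : ℂ_[3]} (hx : ‖x‖ < 1) : ∃ v, L.HasValueAt x v := by
  have hsum : Summable (fun k : ℕ ↦ ((PowerSeries.coeff k L : unrIntegers 3) : ℂ_[3]) * x ^ k) := by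
    refine Summable.of_norm_bounded (g := fun k : ℕ ↦ ‖x‖ ^ k)
      (summable_geometric_of_lt_one (norm_nonneg x) hx) (fun k ↦ ?_)
    rw [norm_mul, norm_pow]
    calc ‖((PowerSeries.coeff k L : unrIntegers 3) : ℂ_[3])‖ * ‖x‖ ^ k ≤ 1 * ‖x‖ ^ k := by
          gcongr; exact norm_le_one_of_mem_unrIntegers (SetLike.coe_mem _)
      _ = ‖x‖ ^ k := one_mul _
  exact ⟨_, hsum.hasSum⟩

/-- **THE SQUEEZE, FINAL FORM (PROVED): only K1 (`C⁺`), P1 (unit coefficient ⟹ unit-disc values of size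
`‖ζ−1‖^λ`) and the analytic `μ = 0` of a BDP frame remain as hypotheses; conclusion = the crux's conclusion
for that datum.** -/
theorem twinAlgMuZero_conclusion_of_squeeze (hK : TwistedOnePointKolyvaginAtThree)
    (hP1 : UnitCoeffValuesAtTorsionPoints)
    (W' : WeierstrassCurve ℚ) [W'.IsElliptic] [W'.IsGloballyMinimal] (N' : ℕ) [NeZero N'] (K : Type) [Field K]
    [NumberField K] (Dt' : Literature.NumberTheory.EllipticCurves.ModularForms.ModularParametrizationData W' N')
    (hbucket : Literature.NumberTheory.EllipticCurves.Rank1Residual.Mult W' 3 ∧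
        ¬ 3 ∣ padicValInt 3 W'.minimalDiscriminantInt ∨
      Literature.NumberTheory.EllipticCurves.Rank1Residual.GoodSS W' 3 ∧ W'.frobeniusTrace 3 = 0)
    (hsurj : W'.HasSurjectiveModNGaloisRep 3) (hN : W'.conductorNorm ℤ = N')
    (hK' : Literature.NumberTheory.EllipticCurves.IsImaginaryQuadratic K)
    (hH : Literature.NumberTheory.EllipticCurves.SatisfiesHeegnerHypothesis N' K) (hodd : Odd (NumberField.discr K))
    (κ : Literature.NumberTheory.EllipticCurves.ZpExtension K 3) (hκ : κ.IsAnticyclotomic)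
    (γ : Field.absoluteGaloisGroup K) [Fact (κ.IsTopGenerator γ)]
    (𝔭 : IsDedekindDomain.HeightOneSpectrum (NumberField.RingOfIntegers K))
    (h𝔭 : ((3 : ℕ) : NumberField.RingOfIntegers K) ∈ 𝔭.asIdeal)
    (he : 𝔭.asIdeal.ramificationIdx (NumberField.RingOfIntegers ℚ) = 1)
    (hf : 𝔭.asIdeal.inertiaDeg (NumberField.RingOfIntegers ℚ) = 1)
    (𝔭' : IsDedekindDomain.HeightOneSpectrum (NumberField.RingOfIntegers K))
    (h𝔭' : ((3 : ℕ) : NumberField.RingOfIntegers K) ∈ 𝔭'.asIdeal) (hne : 𝔭' ≠ 𝔭)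
    (ι' : PadicAlgCl 3 ≃+* ℂ)
    (hι : Summit.BirchSwinnertonDyer.BirchSwinnertonDyer.Theorems.SchneiderFree.BranchInducesPrime 3 ι' 𝔭)
    (ΩK : ℂ) (Ωp : ℂ_[3]) (L' : Literature.NumberTheory.EllipticCurves.UnrSeries 3) (hΩK : ΩK ≠ 0) (hΩp : Ωp ≠ 0)
    (hL : Literature.NumberTheory.EllipticCurves.IsBDPLFunction ι' 𝔭 κ γ Dt'.f ΩK Ωp L')
    (hμ : ∃ i : ℕ, ‖((PowerSeries.coeff i L' : unrIntegers 3) : ℂ_[3])‖ = 1) :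
    Module.IsTorsion (IwasawaAlgebra 3)
        (Summit.BirchSwinnertonDyer.Rank1Residual.X11b.AcSelmer.XAc (W'.baseChange K) 3 κ 𝔭' ∅ γ) ∧
      ∃ g' : UnrSeries 3,
        (Summit.BirchSwinnertonDyer.Rank1Residual.X11b.AcSelmer.XAc.charIdeal (W'.baseChange K) 3 κ 𝔭' ∅ γ).map
            (PowerSeries.map (Summit.BirchSwinnertonDyer.Rank1Residual.X11b.Halves.toUnr 3)) = Ideal.span {g'} ∧
          ∃ i : ℕ, ‖((PowerSeries.coeff i g' : unrIntegers 3) : ℂ_[3])‖ = 1 := by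
  have hroots : ∀ m : ℕ, 1 ≤ m → ∃ ζ : ℂ_[3], IsPrimitiveRoot ζ (3 ^ m) :=
    fun m _ ↦ exists_isPrimitiveRoot_padicComplex m
  have hval : ∀ (L : UnrSeries 3) (m : ℕ), 1 ≤ m → ∀ ζ : ℂ_[3], IsPrimitiveRoot ζ (3 ^ m) →
      ∃ v, L.HasValueAt (ζ - 1) v := by
    intro L m hm ζ hζ
    refine exists_hasValueAt L ?_
    -- ‖ζ - 1‖ ^ φ(3^m) = 3⁻¹ < 1 with φ(3^m) ≥ 1 forces ‖ζ - 1‖ < 1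
    have hφ := primitiveRootNormAtThree_holds m hm ζ hζ
    by_contra hge
    push_neg at hge
    have : (1 : ℝ) ≤ ‖ζ - 1‖ ^ Nat.totient (3 ^ m) := one_le_pow₀ hge
    rw [hφ] at this
    norm_num at this
  exact conclusion_of_boundedCharLayers' (W'.baseChange K) κ 𝔭' γ
    (boundedCharLayers_of_squeeze hK hP1 primitiveRootNormAtThree_holds hroots hval W' N' K Dt' hbucket hsurj hN
      hK' hH hodd κ hκ γ 𝔭 h𝔭 he hf 𝔭' h𝔭' hne ι' hι ΩK Ωp L' hΩK hΩp hL hμ)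

/-! ### §7 P1 PROVED (elementary ultrametric estimate — no Weierstrass preparation, no discreteness of `R₀`) -/

theorem unitCoeffValuesAtTorsionPoints_holds : UnitCoeffValuesAtTorsionPoints := by
  intro L hex
  classical
  have hc1 : ∀ k, ‖((PowerSeries.coeff k L : unrIntegers 3) : ℂ_[3])‖ ≤ 1 :=
    fun k ↦ norm_le_one_of_mem_unrIntegers (SetLike.coe_mem _)
  -- λ = least index of a unit coefficient
  obtain ⟨lam, hlam, hmin⟩ : ∃ lam : ℕ, ‖((PowerSeries.coeff lam L : unrIntegers 3) : ℂ_[3])‖ = 1 ∧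
      ∀ k, k < lam → ‖((PowerSeries.coeff k L : unrIntegers 3) : ℂ_[3])‖ ≠ 1 :=
    ⟨Nat.find hex, Nat.find_spec hex, fun k hk ↦ Nat.find_min hex hk⟩
  have hlt : ∀ k, k < lam → ‖((PowerSeries.coeff k L : unrIntegers 3) : ℂ_[3])‖ < 1 :=
    fun k hk ↦ lt_of_le_of_ne (hc1 k) (hmin k hk)
  -- δ = a common bound < 1 for the earlier coefficients
  obtain ⟨δ, hδ0, hδ1, hδk⟩ : ∃ δ : ℝ, 0 ≤ δ ∧ δ < 1 ∧
      ∀ k, k < lam → ‖((PowerSeries.coeff k L : unrIntegers 3) : ℂ_[3])‖ ≤ δ := by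
    refine ⟨((Finset.range lam).sup (fun k ↦ ‖((PowerSeries.coeff k L : unrIntegers 3) : ℂ_[3])‖₊) : NNReal),
      NNReal.coe_nonneg _, ?_, ?_⟩
    · have : (Finset.range lam).sup (fun k ↦ ‖((PowerSeries.coeff k L : unrIntegers 3) : ℂ_[3])‖₊) < 1 := by
        rw [Finset.sup_lt_iff (by simp)]
        intro k hk
        have h := hlt k (Finset.mem_range.1 hk)
        rw [← coe_nnnorm] at h
        exact_mod_cast h
      exact_mod_cast this
    · intro k hk
      have h : ‖((PowerSeries.coeff k L : unrIntegers 3) : ℂ_[3])‖₊ ≤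
          (Finset.range lam).sup (fun k ↦ ‖((PowerSeries.coeff k L : unrIntegers 3) : ℂ_[3])‖₊) :=
        Finset.le_sup (f := fun k ↦ ‖((PowerSeries.coeff k L : unrIntegers 3) : ℂ_[3])‖₊) (Finset.mem_range.2 hk)
      rw [← coe_nnnorm]
      exact_mod_cast h
  -- choose n₀ with δ^{n₀} < 3^{-λ}; m₀ := max n₀ 1
  obtain ⟨n₀, hn₀⟩ : ∃ n₀ : ℕ, δ ^ n₀ < ((3 : ℝ)⁻¹) ^ lam :=
    exists_pow_lt_of_lt_one (pow_pos (by norm_num) lam) hδ1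
  refine ⟨lam, max n₀ 1, fun m hm ζ hζ v hv ↦ ?_⟩
  have hm1 : 1 ≤ m := le_trans (le_max_right _ _) hm
  have hn₀m : n₀ ≤ Nat.totient (3 ^ m) := by
    have h1 : n₀ ≤ m := le_trans (le_max_left _ _) hm
    rw [Nat.totient_prime_pow Nat.prime_three (by omega)]
    have h2 : m - 1 < 3 ^ (m - 1) := Nat.lt_pow_self (by norm_num)
    omega
  -- ρ = ‖ζ − 1‖ : ρ^φ = 3⁻¹, 0 < ρ < 1
  have hρφ : ‖ζ - 1‖ ^ Nat.totient (3 ^ m) = (3 : ℝ)⁻¹ := primitiveRootNormAtThree_holds m hm1 ζ hζ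
  have hρ0 : 0 ≤ ‖ζ - 1‖ := norm_nonneg _
  have hρ1 : ‖ζ - 1‖ < 1 := by
    by_contra hge
    push_neg at hge
    have : (1 : ℝ) ≤ ‖ζ - 1‖ ^ Nat.totient (3 ^ m) := one_le_pow₀ hge
    rw [hρφ] at this
    norm_num at this
  have hρpos : 0 < ‖ζ - 1‖ := by
    rcases hρ0.eq_or_lt with h | h
    · exfalso
      have hφpos : Nat.totient (3 ^ m) ≠ 0 := (Nat.totient_pos.2 (pow_pos (by norm_num) m)).ne'
      rw [← h, zero_pow hφpos] at hρφ
      norm_num at hρφ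
    · exact h
  have hδρ : δ < ‖ζ - 1‖ ^ lam := by
    have h1 : δ ^ Nat.totient (3 ^ m) < (‖ζ - 1‖ ^ lam) ^ Nat.totient (3 ^ m) := by
      calc δ ^ Nat.totient (3 ^ m) ≤ δ ^ n₀ := pow_le_pow_of_le_one hδ0 hδ1.le hn₀m
        _ < ((3 : ℝ)⁻¹) ^ lam := hn₀
        _ = (‖ζ - 1‖ ^ lam) ^ Nat.totient (3 ^ m) := by rw [← pow_mul, mul_comm, pow_mul, hρφ]
    exact lt_of_pow_lt_pow_left₀ _ (by positivity) h1
  -- the terms: the λ-term has norm ρ^λ, every other term has norm ≤ η < ρ^λ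
  have htlam : ‖((PowerSeries.coeff lam L : unrIntegers 3) : ℂ_[3]) * (ζ - 1) ^ lam‖ = ‖ζ - 1‖ ^ lam := by
    rw [norm_mul, norm_pow, hlam, one_mul]
  have hηlt : max δ (‖ζ - 1‖ ^ (lam + 1)) < ‖ζ - 1‖ ^ lam :=
    max_lt hδρ (by rw [pow_succ]; exact mul_lt_of_lt_one_right (pow_pos hρpos _) hρ1)
  have hη0 : 0 ≤ max δ (‖ζ - 1‖ ^ (lam + 1)) := le_max_of_le_left hδ0
  have hother : ∀ k, k ≠ lam →
      ‖((PowerSeries.coeff k L : unrIntegers 3) : ℂ_[3]) * (ζ - 1) ^ k‖ ≤ max δ (‖ζ - 1‖ ^ (lam + 1)) := by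
    intro k hk
    rw [norm_mul, norm_pow]
    rcases lt_or_gt_of_ne hk with hk' | hk'
    · calc ‖((PowerSeries.coeff k L : unrIntegers 3) : ℂ_[3])‖ * ‖ζ - 1‖ ^ k ≤ δ * 1 :=
            mul_le_mul (hδk k hk') (pow_le_one₀ hρ0 hρ1.le) (by positivity) hδ0
        _ ≤ max δ (‖ζ - 1‖ ^ (lam + 1)) := by rw [mul_one]; exact le_max_left _ _
    · calc ‖((PowerSeries.coeff k L : unrIntegers 3) : ℂ_[3])‖ * ‖ζ - 1‖ ^ k ≤ 1 * ‖ζ - 1‖ ^ (lam + 1) :=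
            mul_le_mul (hc1 k) (pow_le_pow_of_le_one hρ0 hρ1.le (by omega)) (by positivity) zero_le_one
        _ ≤ max δ (‖ζ - 1‖ ^ (lam + 1)) := by rw [one_mul]; exact le_max_right _ _
  -- split the convergent sum into the λ-term and the rest
  have hv' : HasSum (fun k : ℕ ↦ ((PowerSeries.coeff k L : unrIntegers 3) : ℂ_[3]) * (ζ - 1) ^ k) v := hv
  have hsingle : HasSum (fun k : ℕ ↦ if k = lam then
      ((PowerSeries.coeff lam L : unrIntegers 3) : ℂ_[3]) * (ζ - 1) ^ lam else 0)
      (((PowerSeries.coeff lam L : unrIntegers 3) : ℂ_[3]) * (ζ - 1) ^ lam) := hasSum_ite_eq lam _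
  have hrest : HasSum (fun k : ℕ ↦ if k = lam then 0 else
      ((PowerSeries.coeff k L : unrIntegers 3) : ℂ_[3]) * (ζ - 1) ^ k)
      (v - ((PowerSeries.coeff lam L : unrIntegers 3) : ℂ_[3]) * (ζ - 1) ^ lam) := by
    have := hv'.sub hsingle
    have hfun : (fun k : ℕ ↦ if k = lam then (0 : ℂ_[3]) else
        ((PowerSeries.coeff k L : unrIntegers 3) : ℂ_[3]) * (ζ - 1) ^ k) =
        (fun b : ℕ ↦ ((PowerSeries.coeff b L : unrIntegers 3) : ℂ_[3]) * (ζ - 1) ^ b -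
          if b = lam then ((PowerSeries.coeff lam L : unrIntegers 3) : ℂ_[3]) * (ζ - 1) ^ lam else 0) := by
      ext k
      by_cases h : k = lam
      · subst h; simp
      · simp [h]
    rw [hfun]
    exact this
  have hrest_norm : ‖v - ((PowerSeries.coeff lam L : unrIntegers 3) : ℂ_[3]) * (ζ - 1) ^ lam‖ ≤
      max δ (‖ζ - 1‖ ^ (lam + 1)) := by
    rw [← hrest.tsum_eq]
    refine IsUltrametricDist.norm_tsum_le_of_forall_le_of_nonneg hη0 (fun k ↦ ?_)
    split_ifs with h
    · simpa using hη0
    · exact hother k h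
  have hne : ‖((PowerSeries.coeff lam L : unrIntegers 3) : ℂ_[3]) * (ζ - 1) ^ lam‖ ≠
      ‖v - ((PowerSeries.coeff lam L : unrIntegers 3) : ℂ_[3]) * (ζ - 1) ^ lam‖ := by
    rw [htlam]
    exact ne_of_gt (lt_of_le_of_lt hrest_norm hηlt)
  calc ‖v‖ = ‖((PowerSeries.coeff lam L : unrIntegers 3) : ℂ_[3]) * (ζ - 1) ^ lam +
        (v - ((PowerSeries.coeff lam L : unrIntegers 3) : ℂ_[3]) * (ζ - 1) ^ lam)‖ := by rw [add_sub_cancel]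
    _ = max ‖((PowerSeries.coeff lam L : unrIntegers 3) : ℂ_[3]) * (ζ - 1) ^ lam‖
        ‖v - ((PowerSeries.coeff lam L : unrIntegers 3) : ℂ_[3]) * (ζ - 1) ^ lam‖ :=
          IsUltrametricDist.norm_add_eq_max_of_norm_ne_norm hne
    _ = ‖ζ - 1‖ ^ lam := by
          rw [htlam]
          exact max_eq_left (le_of_lt (lt_of_le_of_lt hrest_norm hηlt))

/-- **THE SQUEEZE, UNCONDITIONAL FORM (PROVED): `C⁺ = TwistedOnePointKolyvaginAtThree` ALONE, plus the analytic
`μ = 0` of a BDP frame, gives the conclusion of `TwinAlgMuZeroAtThree` for that datum.** -/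
theorem twinAlgMuZero_conclusion_of_C_plus (hK : TwistedOnePointKolyvaginAtThree)
    (W' : WeierstrassCurve ℚ) [W'.IsElliptic] [W'.IsGloballyMinimal] (N' : ℕ) [NeZero N'] (K : Type) [Field K]
    [NumberField K] (Dt' : Literature.NumberTheory.EllipticCurves.ModularForms.ModularParametrizationData W' N')
    (hbucket : Literature.NumberTheory.EllipticCurves.Rank1Residual.Mult W' 3 ∧
        ¬ 3 ∣ padicValInt 3 W'.minimalDiscriminantInt ∨
      Literature.NumberTheory.EllipticCurves.Rank1Residual.GoodSS W' 3 ∧ W'.frobeniusTrace 3 = 0)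
    (hsurj : W'.HasSurjectiveModNGaloisRep 3) (hN : W'.conductorNorm ℤ = N')
    (hK' : Literature.NumberTheory.EllipticCurves.IsImaginaryQuadratic K)
    (hH : Literature.NumberTheory.EllipticCurves.SatisfiesHeegnerHypothesis N' K) (hodd : Odd (NumberField.discr K))
    (κ : Literature.NumberTheory.EllipticCurves.ZpExtension K 3) (hκ : κ.IsAnticyclotomic)
    (γ : Field.absoluteGaloisGroup K) [Fact (κ.IsTopGenerator γ)]
    (𝔭 : IsDedekindDomain.HeightOneSpectrum (NumberField.RingOfIntegers K))
    (h𝔭 : ((3 : ℕ) : NumberField.RingOfIntegers K) ∈ 𝔭.asIdeal)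
    (he : 𝔭.asIdeal.ramificationIdx (NumberField.RingOfIntegers ℚ) = 1)
    (hf : 𝔭.asIdeal.inertiaDeg (NumberField.RingOfIntegers ℚ) = 1)
    (𝔭' : IsDedekindDomain.HeightOneSpectrum (NumberField.RingOfIntegers K))
    (h𝔭' : ((3 : ℕ) : NumberField.RingOfIntegers K) ∈ 𝔭'.asIdeal) (hne : 𝔭' ≠ 𝔭)
    (ι' : PadicAlgCl 3 ≃+* ℂ)
    (hι : Summit.BirchSwinnertonDyer.BirchSwinnertonDyer.Theorems.SchneiderFree.BranchInducesPrime 3 ι' 𝔭)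
    (ΩK : ℂ) (Ωp : ℂ_[3]) (L' : Literature.NumberTheory.EllipticCurves.UnrSeries 3) (hΩK : ΩK ≠ 0) (hΩp : Ωp ≠ 0)
    (hL : Literature.NumberTheory.EllipticCurves.IsBDPLFunction ι' 𝔭 κ γ Dt'.f ΩK Ωp L')
    (hμ : ∃ i : ℕ, ‖((PowerSeries.coeff i L' : unrIntegers 3) : ℂ_[3])‖ = 1) :
    Module.IsTorsion (IwasawaAlgebra 3)
        (Summit.BirchSwinnertonDyer.Rank1Residual.X11b.AcSelmer.XAc (W'.baseChange K) 3 κ 𝔭' ∅ γ) ∧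
      ∃ g' : UnrSeries 3,
        (Summit.BirchSwinnertonDyer.Rank1Residual.X11b.AcSelmer.XAc.charIdeal (W'.baseChange K) 3 κ 𝔭' ∅ γ).map
            (PowerSeries.map (Summit.BirchSwinnertonDyer.Rank1Residual.X11b.Halves.toUnr 3)) = Ideal.span {g'} ∧
          ∃ i : ℕ, ‖((PowerSeries.coeff i g' : unrIntegers 3) : ℂ_[3])‖ = 1 :=
  twinAlgMuZero_conclusion_of_squeeze hK unitCoeffValuesAtTorsionPoints_holds W' N' K Dt' hbucket hsurj hN hK' hH
    hodd κ hκ γ 𝔭 h𝔭 he hf 𝔭' h𝔭' hne ι' hι ΩK Ωp L' hΩK hΩp hL hμ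

/-! ### §8 The transfer by NAME: `C⁺ ∧ (frame with analytic μ = 0) ⟹ TwinAlgMuZeroAtThree` (PROVED) -/

/-- **Frame-with-μ supply (support; W′-level reading of the kernel inputs).** For every datum of
`TwinAlgMuZeroAtThree` there is a BDP frame `(ι′, Ω_K, Ω_p, L′)` of `f_{E′}` at the branch prime `𝔭` whose
`L′ ∈ R₀⟦T⟧` has a unit coefficient (analytic `μ = 0`).  Existence of the frame = the route's frame leaves
(`TwinWanFrameAtThreeGoodSSApZero` for C₀ without its Wan clause; `TwinDegreeFrameAtThreeMultTresT`-side for B);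
the unit coefficient = `TwinMuZeroAtThree` read at the twin (Hsieh 2014 Thm B / Castella 2018 are `p ≥ 5`: same open
status as the kernel's analytic-μ input). -/
def TwinFrameMuSupplyAtThree : Prop :=
  ∀ (W' : WeierstrassCurve ℚ) [W'.IsElliptic] [W'.IsGloballyMinimal] (N' : ℕ) [NeZero N'] (K : Type) [Field K]
    [NumberField K] (Dt' : Literature.NumberTheory.EllipticCurves.ModularForms.ModularParametrizationData W' N'),
    (Literature.NumberTheory.EllipticCurves.Rank1Residual.Mult W' 3 ∧ ¬ 3 ∣ padicValInt 3 W'.minimalDiscriminantInt ∨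
      Literature.NumberTheory.EllipticCurves.Rank1Residual.GoodSS W' 3 ∧ W'.frobeniusTrace 3 = 0) →
    W'.HasSurjectiveModNGaloisRep 3 → W'.conductorNorm ℤ = N' →
    Literature.NumberTheory.EllipticCurves.IsImaginaryQuadratic K →
    Literature.NumberTheory.EllipticCurves.SatisfiesHeegnerHypothesis N' K → Odd (NumberField.discr K) →
    ∀ (κ : Literature.NumberTheory.EllipticCurves.ZpExtension K 3), κ.IsAnticyclotomic →
    ∀ (γ : Field.absoluteGaloisGroup K) [Fact (κ.IsTopGenerator γ)]
      (𝔭 : IsDedekindDomain.HeightOneSpectrum (NumberField.RingOfIntegers K)),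
      ((3 : ℕ) : NumberField.RingOfIntegers K) ∈ 𝔭.asIdeal →
      𝔭.asIdeal.ramificationIdx (NumberField.RingOfIntegers ℚ) = 1 →
      𝔭.asIdeal.inertiaDeg (NumberField.RingOfIntegers ℚ) = 1 →
    ∀ (𝔭' : IsDedekindDomain.HeightOneSpectrum (NumberField.RingOfIntegers K)),
      ((3 : ℕ) : NumberField.RingOfIntegers K) ∈ 𝔭'.asIdeal → 𝔭' ≠ 𝔭 →
    ∃ (ι' : PadicAlgCl 3 ≃+* ℂ),
      Summit.BirchSwinnertonDyer.BirchSwinnertonDyer.Theorems.SchneiderFree.BranchInducesPrime 3 ι' 𝔭 ∧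
      ∃ (ΩK : ℂ) (Ωp : ℂ_[3]) (L' : Literature.NumberTheory.EllipticCurves.UnrSeries 3), ΩK ≠ 0 ∧ Ωp ≠ 0 ∧
        Literature.NumberTheory.EllipticCurves.IsBDPLFunction ι' 𝔭 κ γ Dt'.f ΩK Ωp L' ∧
        ∃ i : ℕ, ‖((PowerSeries.coeff i L' : unrIntegers 3) : ℂ_[3])‖ = 1

/-- **TRANSFER (PROVED, concludes the crux BY NAME): `C⁺ → (frame ∧ analytic μ = 0) → TwinAlgMuZeroAtThree`.** -/
theorem TwinAlgMuZeroAtThree_of_onePointSqueeze (hK : TwistedOnePointKolyvaginAtThree)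
    (hS : TwinFrameMuSupplyAtThree) :
    Summit.BirchSwinnertonDyer.BirchSwinnertonDyer.Theses.UniversalToricDescent.TwinAlgMuZeroAtThree := by
  intro W' _ _ N' _ K _ _ Dt' hbucket hsurj hN hK' hH hodd κ hκ γ _ 𝔭 h𝔭 he hf 𝔭' h𝔭' hne
  obtain ⟨ι', hι, ΩK, Ωp, L', hΩK, hΩp, hL, hμ⟩ :=
    hS W' N' K Dt' hbucket hsurj hN hK' hH hodd κ hκ γ 𝔭 h𝔭 he hf 𝔭' h𝔭' hne
  exact twinAlgMuZero_conclusion_of_C_plus hK W' N' K Dt' hbucket hsurj hN hK' hH hodd κ hκ γ 𝔭 h𝔭 he hf 𝔭' h𝔭'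
    hne ι' hι ΩK Ωp L' hΩK hΩp hL hμ

/-! ### §9 SLACK VARIANT (typing checklist 4c(iv)): an error LINEAR in `φ(3^m)` with coefficient `c < 1` is still free

`μ` is an integer: if `log₃ #(X′/Φ_m X′) ≤ c·φ(3^m) + O(1)` with `c < 1` then `μ(X′) ≤ c < 1`, so `μ(X′) = 0`.  The typed `C⁺`
above asserts the sharp form `c = 0` (what S1–S4 predict: every error is a twisted (co)invariant of a fixed finite module or a
local resolvent term, bounded in `O_χ`-length).  Should a port of S4 (ramified-`χ` `p`-adic Gross–Zagier at `3 ∥ N′` or `a₃ = 0`)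
or the logarithm/divisibility comparison on the formal group over the highly ramified layers `K_{m,w′}` turn out to carry an
error `c·φ(3^m)` with `0 < c < 1`, the line survives with `C⁺_slack` below in place of `C⁺`, at the price of replacing the
Nakayama criterion P2 by the structure-theoretic criterion P2′ (`#(X/Φ_m X) = 3^{μφ(3^m) + λ + O(1)}` for torsion `X` with finite
layers).  `C⁺ ⟹ C⁺_slack` (PROVED, `c = 0`); `P2′ → C⁺_slack → supply → crux` (PROVED modulo the typed P2′). -/

/-- Sub-linear character-layer growth: `#(X/Φ_m X) ≤ 3^{c·φ(3^m) + B}` for `m ≥ m₀`, some `c < 1`. -/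
def SublinearCharLayers (X : Type) [AddCommGroup X] [Module (IwasawaAlgebra 3) X] : Prop :=
  ∃ c : ℝ, c < 1 ∧ ∃ B m₀ : ℕ, ∀ m : ℕ, m₀ ≤ m → Finite (CharLayer X m) ∧
    (Nat.card (CharLayer X m) : ℝ) ≤ (3 : ℝ) ^ (c * (Nat.totient (3 ^ m) : ℝ) + (B : ℝ))

/-- **P2′ (support Prop, typed, NOT proved here; structure theory of f.g. `Λ`-modules).** Sub-linear character-layer growth
with coefficient `c < 1` forces `X/3X` finite (i.e. `Λ`-torsion with `μ = 0`): for a f.g. `Λ`-module with one finite layer `X` is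
torsion, and then `log₃ #(X/Φ_m X) = μ(X)·φ(3^m) + λ(X) + O(1)` (`#Λ/(f, Φ_m) = 3^{v₃ N_{ℚ₃(ζ)/ℚ₃} f(ζ−1)}`, pseudo-isomorphism
changes layers by a bounded amount), so `μ ≤ c < 1`.  Washington §13.2–13.3 style; the `c = 0` case is the PROVED P2. -/
def SublinearCharLayersCriterion : Prop :=
  ∀ (X : Type) [AddCommGroup X] [Module (IwasawaAlgebra 3) X] [Module.Finite (IwasawaAlgebra 3) X],
    SublinearCharLayers X → Finite (X ⧸ (augIdealP 3 • (⊤ : Submodule (IwasawaAlgebra 3) X)))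

theorem sublinearCharLayers_of_bounded (X : Type) [AddCommGroup X] [Module (IwasawaAlgebra 3) X]
    (h : BoundedCharLayers X) : SublinearCharLayers X := by
  obtain ⟨B, m₀, h⟩ := h
  refine ⟨0, zero_lt_one, B, m₀, fun m hm ↦ ⟨(h m hm).1, ?_⟩⟩
  have h2 := (h m hm).2
  rw [zero_mul, zero_add, Real.rpow_natCast]
  exact_mod_cast h2

/-- **K1_slack = C⁺_slack**: as `TwistedOnePointKolyvaginAtThree`, with the bound `3^{c·φ(3^m) + B}` for some `c < 1`. -/
def TwistedOnePointKolyvaginAtThreeSlack : Prop :=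
  ∀ (W' : WeierstrassCurve ℚ) [W'.IsElliptic] [W'.IsGloballyMinimal] (N' : ℕ) [NeZero N'] (K : Type) [Field K]
    [NumberField K] (Dt' : Literature.NumberTheory.EllipticCurves.ModularForms.ModularParametrizationData W' N'),
    (Literature.NumberTheory.EllipticCurves.Rank1Residual.Mult W' 3 ∧ ¬ 3 ∣ padicValInt 3 W'.minimalDiscriminantInt ∨
      Literature.NumberTheory.EllipticCurves.Rank1Residual.GoodSS W' 3 ∧ W'.frobeniusTrace 3 = 0) →
    W'.HasSurjectiveModNGaloisRep 3 → W'.conductorNorm ℤ = N' →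
    Literature.NumberTheory.EllipticCurves.IsImaginaryQuadratic K →
    Literature.NumberTheory.EllipticCurves.SatisfiesHeegnerHypothesis N' K → Odd (NumberField.discr K) →
    ∀ (κ : Literature.NumberTheory.EllipticCurves.ZpExtension K 3), κ.IsAnticyclotomic →
    ∀ (γ : Field.absoluteGaloisGroup K) [Fact (κ.IsTopGenerator γ)]
      (𝔭 : IsDedekindDomain.HeightOneSpectrum (NumberField.RingOfIntegers K)),
      ((3 : ℕ) : NumberField.RingOfIntegers K) ∈ 𝔭.asIdeal →
      𝔭.asIdeal.ramificationIdx (NumberField.RingOfIntegers ℚ) = 1 →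
      𝔭.asIdeal.inertiaDeg (NumberField.RingOfIntegers ℚ) = 1 →
    ∀ (𝔭' : IsDedekindDomain.HeightOneSpectrum (NumberField.RingOfIntegers K)),
      ((3 : ℕ) : NumberField.RingOfIntegers K) ∈ 𝔭'.asIdeal → 𝔭' ≠ 𝔭 →
    ∀ (ι' : PadicAlgCl 3 ≃+* ℂ),
      Summit.BirchSwinnertonDyer.BirchSwinnertonDyer.Theorems.SchneiderFree.BranchInducesPrime 3 ι' 𝔭 →
    ∀ (ΩK : ℂ) (Ωp : ℂ_[3]) (L' : Literature.NumberTheory.EllipticCurves.UnrSeries 3), ΩK ≠ 0 → Ωp ≠ 0 →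
      Literature.NumberTheory.EllipticCurves.IsBDPLFunction ι' 𝔭 κ γ Dt'.f ΩK Ωp L' →
    ∃ c : ℝ, c < 1 ∧ ∃ B m₀ : ℕ, ∀ m : ℕ, m₀ ≤ m → ∀ ζ : ℂ_[3], IsPrimitiveRoot ζ (3 ^ m) → ∀ v : ℂ_[3],
      L'.HasValueAt (ζ - 1) v → v ≠ 0 →
      Finite (CharLayer (Summit.BirchSwinnertonDyer.Rank1Residual.X11b.AcSelmer.XAc (W'.baseChange K) 3 κ 𝔭' ∅ γ) m) ∧
        (Nat.card (CharLayer (Summit.BirchSwinnertonDyer.Rank1Residual.X11b.AcSelmer.XAc (W'.baseChange K) 3 κ 𝔭' ∅ γ) m) : ℝ)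
          * ‖v‖ ^ Nat.totient (3 ^ m) ≤ (3 : ℝ) ^ (c * (Nat.totient (3 ^ m) : ℝ) + (B : ℝ))

/-- `C⁺ ⟹ C⁺_slack` (`c = 0`; PROVED). -/
theorem slack_of_C_plus (hK : TwistedOnePointKolyvaginAtThree) : TwistedOnePointKolyvaginAtThreeSlack := by
  intro W' _ _ N' _ K _ _ Dt' hb hs hN hK' hH ho κ hκ γ _ 𝔭 h1 h2 h3 𝔭' h4 h5 ι' hι ΩK Ωp L' hΩK hΩp hL
  obtain ⟨B, m₀, h⟩ := hK W' N' K Dt' hb hs hN hK' hH ho κ hκ γ 𝔭 h1 h2 h3 𝔭' h4 h5 ι' hι ΩK Ωp L' hΩK hΩp hL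
  refine ⟨0, zero_lt_one, B, m₀, fun m hm ζ hζ v hv hv0 ↦ ?_⟩
  obtain ⟨hf, hi⟩ := h m hm ζ hζ v hv hv0
  refine ⟨hf, ?_⟩
  rw [zero_mul, zero_add, Real.rpow_natCast]
  exact hi

/-- Exponent bookkeeping with slack (PROVED). -/
theorem card_le_of_onePoint_slack {c : ℝ} {card B lam φ : ℕ} {nv nz : ℝ}
    (hineq : (card : ℝ) * nv ^ φ ≤ (3 : ℝ) ^ (c * (φ : ℝ) + (B : ℝ))) (hv : nv = nz ^ lam)
    (hz : nz ^ φ = (3 : ℝ)⁻¹) :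
    (card : ℝ) ≤ (3 : ℝ) ^ (c * (φ : ℝ) + ((B + lam : ℕ) : ℝ)) := by
  have hpow : nv ^ φ = ((3 : ℝ) ^ lam)⁻¹ := by
    rw [hv, ← pow_mul, mul_comm, pow_mul, hz, inv_pow]
  rw [hpow] at hineq
  have hlam : (0 : ℝ) < (3 : ℝ) ^ lam := pow_pos (by norm_num) lam
  have h1 : (card : ℝ) ≤ (3 : ℝ) ^ (c * (φ : ℝ) + (B : ℝ)) * (3 : ℝ) ^ lam := by
    have := mul_le_mul_of_nonneg_right hineq hlam.le
    rwa [mul_assoc, inv_mul_cancel₀ hlam.ne', mul_one] at this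
  calc (card : ℝ) ≤ (3 : ℝ) ^ (c * (φ : ℝ) + (B : ℝ)) * (3 : ℝ) ^ lam := h1
    _ = (3 : ℝ) ^ (c * (φ : ℝ) + ((B + lam : ℕ) : ℝ)) := by
        rw [← Real.rpow_natCast (3 : ℝ) lam, ← Real.rpow_add (by norm_num : (0 : ℝ) < 3)]
        congr 1
        push_cast
        ring

/-- **THE SQUEEZE WITH SLACK (PROVED): `C⁺_slack` + P1 + P0 ⟹ sub-linear character layers of `X′`.** -/
theorem sublinearCharLayers_of_squeezeSlack (hK : TwistedOnePointKolyvaginAtThreeSlack)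
    (hP1 : UnitCoeffValuesAtTorsionPoints) (hP0 : PrimitiveRootNormAtThree)
    (hroots : ∀ m : ℕ, 1 ≤ m → ∃ ζ : ℂ_[3], IsPrimitiveRoot ζ (3 ^ m))
    (hval : ∀ (L : UnrSeries 3) (m : ℕ), 1 ≤ m → ∀ ζ : ℂ_[3], IsPrimitiveRoot ζ (3 ^ m) → ∃ v, L.HasValueAt (ζ - 1) v)
    (W' : WeierstrassCurve ℚ) [W'.IsElliptic] [W'.IsGloballyMinimal] (N' : ℕ) [NeZero N'] (K : Type) [Field K]
    [NumberField K] (Dt' : Literature.NumberTheory.EllipticCurves.ModularForms.ModularParametrizationData W' N')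
    (hbucket : Literature.NumberTheory.EllipticCurves.Rank1Residual.Mult W' 3 ∧
        ¬ 3 ∣ padicValInt 3 W'.minimalDiscriminantInt ∨
      Literature.NumberTheory.EllipticCurves.Rank1Residual.GoodSS W' 3 ∧ W'.frobeniusTrace 3 = 0)
    (hsurj : W'.HasSurjectiveModNGaloisRep 3) (hN : W'.conductorNorm ℤ = N')
    (hK' : Literature.NumberTheory.EllipticCurves.IsImaginaryQuadratic K)
    (hH : Literature.NumberTheory.EllipticCurves.SatisfiesHeegnerHypothesis N' K) (hodd : Odd (NumberField.discr K))
    (κ : Literature.NumberTheory.EllipticCurves.ZpExtension K 3) (hκ : κ.IsAnticyclotomic)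
    (γ : Field.absoluteGaloisGroup K) [Fact (κ.IsTopGenerator γ)]
    (𝔭 : IsDedekindDomain.HeightOneSpectrum (NumberField.RingOfIntegers K))
    (h𝔭 : ((3 : ℕ) : NumberField.RingOfIntegers K) ∈ 𝔭.asIdeal)
    (he : 𝔭.asIdeal.ramificationIdx (NumberField.RingOfIntegers ℚ) = 1)
    (hf : 𝔭.asIdeal.inertiaDeg (NumberField.RingOfIntegers ℚ) = 1)
    (𝔭' : IsDedekindDomain.HeightOneSpectrum (NumberField.RingOfIntegers K))
    (h𝔭' : ((3 : ℕ) : NumberField.RingOfIntegers K) ∈ 𝔭'.asIdeal) (hne : 𝔭' ≠ 𝔭)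
    (ι' : PadicAlgCl 3 ≃+* ℂ)
    (hι : Summit.BirchSwinnertonDyer.BirchSwinnertonDyer.Theorems.SchneiderFree.BranchInducesPrime 3 ι' 𝔭)
    (ΩK : ℂ) (Ωp : ℂ_[3]) (L' : Literature.NumberTheory.EllipticCurves.UnrSeries 3) (hΩK : ΩK ≠ 0) (hΩp : Ωp ≠ 0)
    (hL : Literature.NumberTheory.EllipticCurves.IsBDPLFunction ι' 𝔭 κ γ Dt'.f ΩK Ωp L')
    (hμ : ∃ i : ℕ, ‖((PowerSeries.coeff i L' : unrIntegers 3) : ℂ_[3])‖ = 1) :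
    SublinearCharLayers (Summit.BirchSwinnertonDyer.Rank1Residual.X11b.AcSelmer.XAc (W'.baseChange K) 3 κ 𝔭' ∅ γ) := by
  obtain ⟨c, hc, B, m₀, hB⟩ := hK W' N' K Dt' hbucket hsurj hN hK' hH hodd κ hκ γ 𝔭 h𝔭 he hf 𝔭' h𝔭' hne ι' hι ΩK
    Ωp L' hΩK hΩp hL
  obtain ⟨lam, m₁, hlam⟩ := hP1 L' hμ
  refine ⟨c, hc, B + lam, max (max m₀ m₁) 1, fun m hm ↦ ?_⟩
  have hm₀ : m₀ ≤ m := le_trans (le_trans (le_max_left _ _) (le_max_left _ _)) hm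
  have hm₁ : m₁ ≤ m := le_trans (le_trans (le_max_right _ _) (le_max_left _ _)) hm
  have hm1 : 1 ≤ m := le_trans (le_max_right _ _) hm
  obtain ⟨ζ, hζ⟩ := hroots m hm1
  obtain ⟨v, hv⟩ := hval L' m hm1 ζ hζ
  have hvne : v ≠ 0 := by
    intro h0
    have hn := hlam m hm₁ ζ hζ v hv
    rw [h0, norm_zero] at hn
    have hz : ‖ζ - 1‖ ≠ 0 := by
      intro hz
      have h3 := hP0 m hm1 ζ hζ
      rw [hz, zero_pow (Nat.totient_pos.2 (pow_pos (by norm_num) m)).ne'] at h3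
      norm_num at h3
    exact (pow_ne_zero lam hz) hn.symm
  obtain ⟨hfin, hineq⟩ := hB m hm₀ ζ hζ v hv hvne
  exact ⟨hfin, card_le_of_onePoint_slack hineq (hlam m hm₁ ζ hζ v hv) (hP0 m hm1 ζ hζ)⟩

/-- Endgame from sub-linear layers (PROVED modulo the typed P2′). -/
theorem conclusion_of_sublinearCharLayers (hcrit : SublinearCharLayersCriterion)
    {K : Type} [Field K] [NumberField K] (W : WeierstrassCurve K) [W.IsElliptic]
    (κ : ZpExtension K 3) (𝔭 : HeightOneSpectrum (𝓞 K)) (γ : absoluteGaloisGroup K)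
    [Fact (κ.IsTopGenerator γ)] (hX : SublinearCharLayers (XAc W 3 κ 𝔭 ∅ γ)) :
    Module.IsTorsion (IwasawaAlgebra 3) (XAc W 3 κ 𝔭 ∅ γ) ∧
      ∃ g : UnrSeries 3,
        (XAc.charIdeal W 3 κ 𝔭 ∅ γ).map (PowerSeries.map (Halves.toUnr 3)) = Ideal.span {g} ∧
          ∃ i : ℕ, ‖((PowerSeries.coeff i g : unrIntegers 3) : ℂ_[3])‖ = 1 := by
  haveI := XAc.module_finite κ 𝔭 ∅ γ Set.finite_empty (W := W)
  have hfin := hcrit (XAc W 3 κ 𝔭 ∅ γ) hX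
  have hfg := moduleFinite_padicInt_of_finite_quotient_augIdealP 3 (XAc W 3 κ 𝔭 ∅ γ) hfin
  exact isTorsion_and_exists_generator_of_finite_pTorsion W 3 κ 𝔭 ∅ γ Set.finite_empty
    (finite_pTorsion_of_moduleFinite_padicInt W 3 κ 𝔭 ∅ γ hfg)

/-- **TRANSFER WITH SLACK (PROVED modulo P2′): `P2′ → C⁺_slack → (frame ∧ analytic μ = 0) → TwinAlgMuZeroAtThree`.** -/
theorem TwinAlgMuZeroAtThree_of_onePointSqueezeSlack (hcrit : SublinearCharLayersCriterion)
    (hK : TwistedOnePointKolyvaginAtThreeSlack) (hS : TwinFrameMuSupplyAtThree) :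
    Summit.BirchSwinnertonDyer.BirchSwinnertonDyer.Theses.UniversalToricDescent.TwinAlgMuZeroAtThree := by
  intro W' _ _ N' _ K _ _ Dt' hbucket hsurj hN hK' hH hodd κ hκ γ _ 𝔭 h𝔭 he hf 𝔭' h𝔭' hne
  obtain ⟨ι', hι, ΩK, Ωp, L', hΩK, hΩp, hL, hμ⟩ :=
    hS W' N' K Dt' hbucket hsurj hN hK' hH hodd κ hκ γ 𝔭 h𝔭 he hf 𝔭' h𝔭' hne
  have hroots : ∀ m : ℕ, 1 ≤ m → ∃ ζ : ℂ_[3], IsPrimitiveRoot ζ (3 ^ m) :=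
    fun m _ ↦ exists_isPrimitiveRoot_padicComplex m
  have hval : ∀ (L : UnrSeries 3) (m : ℕ), 1 ≤ m → ∀ ζ : ℂ_[3], IsPrimitiveRoot ζ (3 ^ m) →
      ∃ v, L.HasValueAt (ζ - 1) v := by
    intro L m hm ζ hζ
    refine exists_hasValueAt L ?_
    have hφ := primitiveRootNormAtThree_holds m hm ζ hζ
    by_contra hge
    push_neg at hge
    have : (1 : ℝ) ≤ ‖ζ - 1‖ ^ Nat.totient (3 ^ m) := one_le_pow₀ hge
    rw [hφ] at this
    norm_num at this
  exact conclusion_of_sublinearCharLayers hcrit (W'.baseChange K) κ 𝔭' γ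
    (sublinearCharLayers_of_squeezeSlack hK unitCoeffValuesAtTorsionPoints_holds primitiveRootNormAtThree_holds hroots
      hval W' N' K Dt' hbucket hsurj hN hK' hH hodd κ hκ γ 𝔭 h𝔭 he hf 𝔭' h𝔭' hne ι' hι ΩK Ωp L' hΩK hΩp hL hμ)


/-! ### §10 SPARSE-LEVEL VARIANT (PROVED): the squeeze along ANY unbounded set of levels `m` suffices

At `a₃ = 0` the printed ramified-character interpolation formula for the BDP `L`-function — Castella–Wan, arXiv:1506.02538
p. 10 (following Castella–Hsieh): `φ(ℒ_𝔭(f)) = 𝔤(χ_φ⁻¹)·χ_φ(p^n)·p^{-n}·Σ_{σ ∈ Gal(H_{p^n}/K)} χ(σ) log_{ω_f}(z_{p^n}^σ)` for a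
primitive character `φ` of `Γ⁻/p^mΓ⁻` with `n := m − t − a` EVEN — and the signed big logarithm `LOG⁺` (loc. cit. p. 6) live on ONE
parity class of conductor exponents.  The Nakayama criterion needs the layer bound only along an UNBOUNDED set of levels: the
`(Tⁿ,3)`-layers are monotone in `n` and each is a quotient of any character layer of level `m ≥ n + 1`.  So `C⁺` may be weakened
to hold for infinitely many `m` (`C⁺_sparse`), e.g. one parity class — at `a₃ = 0` one signed logarithm then suffices (S4 port). -/

/-- Character layers of bounded order along an unbounded set of levels. -/
def FrequentlyBoundedCharLayers (X : Type) [AddCommGroup X] [Module (IwasawaAlgebra 3) X] : Prop :=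
  ∃ B : ℕ, ∀ m₁ : ℕ, ∃ m : ℕ, m₁ ≤ m ∧ Finite (CharLayer X m) ∧ Nat.card (CharLayer X m) ≤ 3 ^ B

theorem frequently_of_boundedCharLayers (X : Type) [AddCommGroup X] [Module (IwasawaAlgebra 3) X]
    (h : BoundedCharLayers X) : FrequentlyBoundedCharLayers X := by
  obtain ⟨B, m₀, hB⟩ := h
  exact ⟨B, fun m₁ ↦ ⟨max m₀ m₁, le_max_right _ _, hB _ (le_max_left _ _)⟩⟩

/-- The Nakayama endgame from a bound on all `(Tⁿ,3)`-layers (the body of P2's proof, verbatim). -/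
theorem finite_augQuot_of_tnLayerBound (X : Type) [AddCommGroup X] [Module (IwasawaAlgebra 3) X]
    [Module.Finite (IwasawaAlgebra 3) X] {B : ℕ}
    (hQ : ∀ n : ℕ, Finite (X ⧸ (layerIdeal n • (⊤ : Submodule (IwasawaAlgebra 3) X))) ∧
      Nat.card (X ⧸ (layerIdeal n • (⊤ : Submodule (IwasawaAlgebra 3) X))) ≤ 3 ^ B) :
    Finite (X ⧸ (augIdealP 3 • (⊤ : Submodule (IwasawaAlgebra 3) X))) := by
  -- the orders stabilise: `(T^n,3)X = (T^{n+1},3)X` for some `n`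
  obtain ⟨n, hn⟩ := exists_succ_le_of_bounded
    (fun n => Nat.card (X ⧸ (layerIdeal n • (⊤ : Submodule (IwasawaAlgebra 3) X)))) (3 ^ B) (fun n => (hQ n).2)
  have hle : layerIdeal (n + 1) • (⊤ : Submodule (IwasawaAlgebra 3) X) ≤ layerIdeal n • ⊤ :=
    Submodule.smul_mono_left (layerIdeal_anti (Nat.le_succ n))
  haveI := (hQ (n + 1)).1
  have hge : layerIdeal n • (⊤ : Submodule (IwasawaAlgebra 3) X) ≤ layerIdeal (n + 1) • ⊤ :=
    le_of_card_quot_le hle hn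
  -- Nakayama in `Y = X/3X` for `N = T^n Y`
  set P3 : Submodule (IwasawaAlgebra 3) X := Ideal.span {(3 : IwasawaAlgebra 3)} • ⊤ with hP3
  set N : Submodule (IwasawaAlgebra 3) (X ⧸ P3) :=
    Ideal.span {(PowerSeries.X ^ n : IwasawaAlgebra 3)} • ⊤ with hN
  have hXn : ∀ x : X, ∃ w w' : X, (PowerSeries.X ^ n : IwasawaAlgebra 3) • x =
      (PowerSeries.X ^ (n + 1) : IwasawaAlgebra 3) • w + (3 : IwasawaAlgebra 3) • w' := by
    intro x
    have hx : (PowerSeries.X ^ n : IwasawaAlgebra 3) • x ∈ layerIdeal (n + 1) • (⊤ : Submodule _ X) :=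
      hge (Submodule.smul_mem_smul (X_pow_mem_layerIdeal n) Submodule.mem_top)
    exact mem_span_pair_smul_top hx
  have hNle : N ≤ Ideal.span {(PowerSeries.X : IwasawaAlgebra 3)} • N := by
    rw [hN, Submodule.smul_le]
    intro r hr y _
    obtain ⟨a, rfl⟩ := Ideal.mem_span_singleton'.1 hr
    rw [mul_smul]
    refine Submodule.smul_mem _ a ?_
    induction y using Submodule.Quotient.induction_on with
    | H x =>
      obtain ⟨w, w', hw⟩ := hXn x
      rw [← Submodule.Quotient.mk_smul, hw, Submodule.Quotient.mk_add, Submodule.Quotient.mk_smul,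
        Submodule.Quotient.mk_smul]
      have h3w : (Submodule.Quotient.mk ((3 : IwasawaAlgebra 3) • w') : X ⧸ P3) = 0 := by
        rw [Submodule.Quotient.mk_eq_zero, hP3]
        exact Submodule.smul_mem_smul (Ideal.subset_span rfl) Submodule.mem_top
      rw [Submodule.Quotient.mk_smul] at h3w
      rw [h3w, add_zero, pow_succ, mul_comm, mul_smul]
      exact Submodule.smul_mem_smul (Ideal.subset_span rfl)
        (Submodule.smul_mem_smul (Ideal.subset_span rfl) Submodule.mem_top)
  have hNfg : N.FG := by
    haveI : IsNoetherian (IwasawaAlgebra 3) (X ⧸ P3) := isNoetherian_of_isNoetherianRing_of_finite _ _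
    exact IsNoetherian.noetherian N
  have hN0 : N = ⊥ := Submodule.eq_bot_of_le_smul_of_le_jacobson_bot _ N hNfg hNle span_X_le_jacobson_bot
  -- hence `T^n X ⊆ 3X`, so `(T^n,3)X = 3X` and `X/3X` is the finite layer
  have hXn3 : ∀ x : X, (PowerSeries.X ^ n : IwasawaAlgebra 3) • x ∈ P3 := by
    intro x
    have : (Submodule.Quotient.mk ((PowerSeries.X ^ n : IwasawaAlgebra 3) • x) : X ⧸ P3) ∈ N := by
      rw [Submodule.Quotient.mk_smul, hN]
      exact Submodule.smul_mem_smul (Ideal.subset_span rfl) Submodule.mem_top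
    rw [hN0, Submodule.mem_bot] at this
    exact (Submodule.Quotient.mk_eq_zero P3).1 this
  have hEq : layerIdeal n • (⊤ : Submodule (IwasawaAlgebra 3) X) = P3 := by
    apply le_antisymm
    · rw [Submodule.smul_le]
      intro r hr x _
      obtain ⟨a, b, rfl⟩ := Ideal.mem_span_pair.1 hr
      rw [add_smul, mul_smul, mul_smul]
      exact P3.add_mem (P3.smul_mem a (hXn3 x))
        (P3.smul_mem b (Submodule.smul_mem_smul (Ideal.subset_span rfl) Submodule.mem_top))
    · exact Submodule.smul_mono_left
        ((Ideal.span_singleton_le_iff_mem _).2 (three_mem_layerIdeal n))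
  have hC : (PowerSeries.C ((3 : ℕ) : ℤ_[3]) : IwasawaAlgebra 3) = 3 := by
    rw [map_natCast, Nat.cast_ofNat]
  change Finite (X ⧸ (Ideal.span {PowerSeries.C ((3 : ℕ) : ℤ_[3])} • (⊤ : Submodule (IwasawaAlgebra 3) X)))
  rw [hC, ← hP3, ← hEq]
  exact (hQ n).1

/-- **P2-sparse (PROVED).** Bounded character layers along an unbounded set of levels force `X/3X` finite. -/
theorem finite_augQuot_of_frequentlyBoundedCharLayers (X : Type) [AddCommGroup X] [Module (IwasawaAlgebra 3) X]
    [Module.Finite (IwasawaAlgebra 3) X] (hX : FrequentlyBoundedCharLayers X) :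
    Finite (X ⧸ (augIdealP 3 • (⊤ : Submodule (IwasawaAlgebra 3) X))) := by
  obtain ⟨B, hB⟩ := hX
  refine finite_augQuot_of_tnLayerBound X (B := B) fun n ↦ ?_
  obtain ⟨m, hm, hfin, hcard⟩ := hB (n + 1)
  have hm1 : 1 ≤ m := le_trans (by omega) hm
  have hnN : n ≤ 2 * 3 ^ (m - 1) := by
    have h1 : m - 1 < 3 ^ (m - 1) := Nat.lt_pow_self (by norm_num)
    omega
  have hle : Ideal.span {cycLayer m} ≤ layerIdeal n := (span_cycLayer_le _ hm1).trans (layerIdeal_anti hnN)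
  obtain ⟨hf, hc⟩ := finite_quot_of_le (X := X) hle hfin
  exact ⟨hf, hc.trans hcard⟩

/-- **Endgame along sparse levels (PROVED).** -/
theorem conclusion_of_frequentlyBoundedCharLayers {K : Type} [Field K] [NumberField K] (W : WeierstrassCurve K)
    [W.IsElliptic] (κ : ZpExtension K 3) (𝔭 : HeightOneSpectrum (𝓞 K)) (γ : absoluteGaloisGroup K)
    [Fact (κ.IsTopGenerator γ)] (hX : FrequentlyBoundedCharLayers (XAc W 3 κ 𝔭 ∅ γ)) :
    Module.IsTorsion (IwasawaAlgebra 3) (XAc W 3 κ 𝔭 ∅ γ) ∧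
      ∃ g : UnrSeries 3,
        (XAc.charIdeal W 3 κ 𝔭 ∅ γ).map (PowerSeries.map (Halves.toUnr 3)) = Ideal.span {g} ∧
          ∃ i : ℕ, ‖((PowerSeries.coeff i g : unrIntegers 3) : ℂ_[3])‖ = 1 := by
  haveI := XAc.module_finite κ 𝔭 ∅ γ Set.finite_empty (W := W)
  have hfin := finite_augQuot_of_frequentlyBoundedCharLayers (XAc W 3 κ 𝔭 ∅ γ) hX
  have hfg := moduleFinite_padicInt_of_finite_quotient_augIdealP 3 (XAc W 3 κ 𝔭 ∅ γ) hfin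
  exact isTorsion_and_exists_generator_of_finite_pTorsion W 3 κ 𝔭 ∅ γ Set.finite_empty
    (finite_pTorsion_of_moduleFinite_padicInt W 3 κ 𝔭 ∅ γ hfg)

/-- **`C⁺_sparse`**: the one-point squeeze asserted only along an unbounded set of levels `m` (same binders and bound as `C⁺`). -/
def TwistedOnePointKolyvaginAtThreeSparse : Prop :=
  ∀ (W' : WeierstrassCurve ℚ) [W'.IsElliptic] [W'.IsGloballyMinimal] (N' : ℕ) [NeZero N'] (K : Type) [Field K]
    [NumberField K] (Dt' : Literature.NumberTheory.EllipticCurves.ModularForms.ModularParametrizationData W' N'),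
    (Literature.NumberTheory.EllipticCurves.Rank1Residual.Mult W' 3 ∧ ¬ 3 ∣ padicValInt 3 W'.minimalDiscriminantInt ∨
      Literature.NumberTheory.EllipticCurves.Rank1Residual.GoodSS W' 3 ∧ W'.frobeniusTrace 3 = 0) →
    W'.HasSurjectiveModNGaloisRep 3 → W'.conductorNorm ℤ = N' →
    Literature.NumberTheory.EllipticCurves.IsImaginaryQuadratic K →
    Literature.NumberTheory.EllipticCurves.SatisfiesHeegnerHypothesis N' K → Odd (NumberField.discr K) →
    ∀ (κ : Literature.NumberTheory.EllipticCurves.ZpExtension K 3), κ.IsAnticyclotomic →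
    ∀ (γ : Field.absoluteGaloisGroup K) [Fact (κ.IsTopGenerator γ)]
      (𝔭 : IsDedekindDomain.HeightOneSpectrum (NumberField.RingOfIntegers K)),
      ((3 : ℕ) : NumberField.RingOfIntegers K) ∈ 𝔭.asIdeal →
      𝔭.asIdeal.ramificationIdx (NumberField.RingOfIntegers ℚ) = 1 →
      𝔭.asIdeal.inertiaDeg (NumberField.RingOfIntegers ℚ) = 1 →
    ∀ (𝔭' : IsDedekindDomain.HeightOneSpectrum (NumberField.RingOfIntegers K)),
      ((3 : ℕ) : NumberField.RingOfIntegers K) ∈ 𝔭'.asIdeal → 𝔭' ≠ 𝔭 →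
    ∀ (ι' : PadicAlgCl 3 ≃+* ℂ),
      Summit.BirchSwinnertonDyer.BirchSwinnertonDyer.Theorems.SchneiderFree.BranchInducesPrime 3 ι' 𝔭 →
    ∀ (ΩK : ℂ) (Ωp : ℂ_[3]) (L' : Literature.NumberTheory.EllipticCurves.UnrSeries 3), ΩK ≠ 0 → Ωp ≠ 0 →
      Literature.NumberTheory.EllipticCurves.IsBDPLFunction ι' 𝔭 κ γ Dt'.f ΩK Ωp L' →
    ∃ B : ℕ, ∀ m₁ : ℕ, ∃ m : ℕ, m₁ ≤ m ∧ ∀ ζ : ℂ_[3], IsPrimitiveRoot ζ (3 ^ m) → ∀ v : ℂ_[3], L'.HasValueAt (ζ - 1) v →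
      v ≠ 0 →
      Finite (CharLayer (Summit.BirchSwinnertonDyer.Rank1Residual.X11b.AcSelmer.XAc (W'.baseChange K) 3 κ 𝔭' ∅ γ) m) ∧
        (Nat.card (CharLayer (Summit.BirchSwinnertonDyer.Rank1Residual.X11b.AcSelmer.XAc (W'.baseChange K) 3 κ 𝔭' ∅ γ) m) : ℝ)
          * ‖v‖ ^ Nat.totient (3 ^ m) ≤ (3 : ℝ) ^ B

/-! ### §4 The squeeze: exponent bookkeeping (PROVED) -/


/-- `C⁺ ⟹ C⁺_sparse` (PROVED). -/
theorem sparse_of_C_plus (hK : TwistedOnePointKolyvaginAtThree) : TwistedOnePointKolyvaginAtThreeSparse := by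
  intro W' _ _ N' _ K _ _ Dt' hb hs hN hK' hH ho κ hκ γ _ 𝔭 h1 h2 h3 𝔭' h4 h5 ι' hι ΩK Ωp L' hΩK hΩp hL
  obtain ⟨B, m₀, h⟩ := hK W' N' K Dt' hb hs hN hK' hH ho κ hκ γ 𝔭 h1 h2 h3 𝔭' h4 h5 ι' hι ΩK Ωp L' hΩK hΩp hL
  exact ⟨B, fun m₁ ↦ ⟨max m₀ m₁, le_max_right _ _, h _ (le_max_left _ _)⟩⟩

/-- **The squeeze along sparse levels (PROVED).** -/
theorem frequentlyBoundedCharLayers_of_squeezeSparse (hK : TwistedOnePointKolyvaginAtThreeSparse) (hP1 : UnitCoeffValuesAtTorsionPoints)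
    (hP0 : PrimitiveRootNormAtThree)
    (hroots : ∀ m : ℕ, 1 ≤ m → ∃ ζ : ℂ_[3], IsPrimitiveRoot ζ (3 ^ m))
    (hval : ∀ (L : UnrSeries 3) (m : ℕ), 1 ≤ m → ∀ ζ : ℂ_[3], IsPrimitiveRoot ζ (3 ^ m) → ∃ v, L.HasValueAt (ζ - 1) v)
    (W' : WeierstrassCurve ℚ) [W'.IsElliptic] [W'.IsGloballyMinimal] (N' : ℕ) [NeZero N'] (K : Type) [Field K]
    [NumberField K] (Dt' : Literature.NumberTheory.EllipticCurves.ModularForms.ModularParametrizationData W' N')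
    (hbucket : Literature.NumberTheory.EllipticCurves.Rank1Residual.Mult W' 3 ∧
        ¬ 3 ∣ padicValInt 3 W'.minimalDiscriminantInt ∨
      Literature.NumberTheory.EllipticCurves.Rank1Residual.GoodSS W' 3 ∧ W'.frobeniusTrace 3 = 0)
    (hsurj : W'.HasSurjectiveModNGaloisRep 3) (hN : W'.conductorNorm ℤ = N')
    (hK' : Literature.NumberTheory.EllipticCurves.IsImaginaryQuadratic K)
    (hH : Literature.NumberTheory.EllipticCurves.SatisfiesHeegnerHypothesis N' K) (hodd : Odd (NumberField.discr K))
    (κ : Literature.NumberTheory.EllipticCurves.ZpExtension K 3) (hκ : κ.IsAnticyclotomic)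
    (γ : Field.absoluteGaloisGroup K) [Fact (κ.IsTopGenerator γ)]
    (𝔭 : IsDedekindDomain.HeightOneSpectrum (NumberField.RingOfIntegers K))
    (h𝔭 : ((3 : ℕ) : NumberField.RingOfIntegers K) ∈ 𝔭.asIdeal)
    (he : 𝔭.asIdeal.ramificationIdx (NumberField.RingOfIntegers ℚ) = 1)
    (hf : 𝔭.asIdeal.inertiaDeg (NumberField.RingOfIntegers ℚ) = 1)
    (𝔭' : IsDedekindDomain.HeightOneSpectrum (NumberField.RingOfIntegers K))
    (h𝔭' : ((3 : ℕ) : NumberField.RingOfIntegers K) ∈ 𝔭'.asIdeal) (hne : 𝔭' ≠ 𝔭)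
    (ι' : PadicAlgCl 3 ≃+* ℂ)
    (hι : Summit.BirchSwinnertonDyer.BirchSwinnertonDyer.Theorems.SchneiderFree.BranchInducesPrime 3 ι' 𝔭)
    (ΩK : ℂ) (Ωp : ℂ_[3]) (L' : Literature.NumberTheory.EllipticCurves.UnrSeries 3) (hΩK : ΩK ≠ 0) (hΩp : Ωp ≠ 0)
    (hL : Literature.NumberTheory.EllipticCurves.IsBDPLFunction ι' 𝔭 κ γ Dt'.f ΩK Ωp L')
    (hμ : ∃ i : ℕ, ‖((PowerSeries.coeff i L' : unrIntegers 3) : ℂ_[3])‖ = 1) :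
    FrequentlyBoundedCharLayers
      (Summit.BirchSwinnertonDyer.Rank1Residual.X11b.AcSelmer.XAc (W'.baseChange K) 3 κ 𝔭' ∅ γ) := by
  obtain ⟨B, hB⟩ := hK W' N' K Dt' hbucket hsurj hN hK' hH hodd κ hκ γ 𝔭 h𝔭 he hf 𝔭' h𝔭' hne ι' hι ΩK Ωp L'
    hΩK hΩp hL
  obtain ⟨lam, m₁, hlam⟩ := hP1 L' hμ
  refine ⟨B + lam, fun m₂ ↦ ?_⟩
  obtain ⟨m, hm, hBm⟩ := hB (max (max m₂ m₁) 1)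
  have hm₂ : m₂ ≤ m := le_trans (le_trans (le_max_left _ _) (le_max_left _ _)) hm
  have hm₁ : m₁ ≤ m := le_trans (le_trans (le_max_right _ _) (le_max_left _ _)) hm
  have hm1 : 1 ≤ m := le_trans (le_max_right _ _) hm
  obtain ⟨ζ, hζ⟩ := hroots m hm1
  obtain ⟨v, hv⟩ := hval L' m hm1 ζ hζ
  have hvne : v ≠ 0 := by
    intro h0
    have hn := hlam m hm₁ ζ hζ v hv
    rw [h0, norm_zero] at hn
    have hz : ‖ζ - 1‖ ≠ 0 := by
      intro hz
      have h3 := hP0 m hm1 ζ hζ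
      rw [hz, zero_pow (Nat.totient_pos.2 (pow_pos (by norm_num) m)).ne'] at h3
      norm_num at h3
    exact (pow_ne_zero lam hz) hn.symm
  obtain ⟨hfin, hineq⟩ := hBm ζ hζ v hv hvne
  exact ⟨m, hm₂, hfin, card_le_of_onePoint hineq (hlam m hm₁ ζ hζ v hv) (hP0 m hm1 ζ hζ)⟩

/-- **Conclusion of the crux for one datum from `C⁺_sparse` (PROVED).** -/
theorem twinAlgMuZero_conclusion_of_squeezeSparse (hK : TwistedOnePointKolyvaginAtThreeSparse)
    (hP1 : UnitCoeffValuesAtTorsionPoints)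
    (W' : WeierstrassCurve ℚ) [W'.IsElliptic] [W'.IsGloballyMinimal] (N' : ℕ) [NeZero N'] (K : Type) [Field K]
    [NumberField K] (Dt' : Literature.NumberTheory.EllipticCurves.ModularForms.ModularParametrizationData W' N')
    (hbucket : Literature.NumberTheory.EllipticCurves.Rank1Residual.Mult W' 3 ∧
        ¬ 3 ∣ padicValInt 3 W'.minimalDiscriminantInt ∨
      Literature.NumberTheory.EllipticCurves.Rank1Residual.GoodSS W' 3 ∧ W'.frobeniusTrace 3 = 0)
    (hsurj : W'.HasSurjectiveModNGaloisRep 3) (hN : W'.conductorNorm ℤ = N')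
    (hK' : Literature.NumberTheory.EllipticCurves.IsImaginaryQuadratic K)
    (hH : Literature.NumberTheory.EllipticCurves.SatisfiesHeegnerHypothesis N' K) (hodd : Odd (NumberField.discr K))
    (κ : Literature.NumberTheory.EllipticCurves.ZpExtension K 3) (hκ : κ.IsAnticyclotomic)
    (γ : Field.absoluteGaloisGroup K) [Fact (κ.IsTopGenerator γ)]
    (𝔭 : IsDedekindDomain.HeightOneSpectrum (NumberField.RingOfIntegers K))
    (h𝔭 : ((3 : ℕ) : NumberField.RingOfIntegers K) ∈ 𝔭.asIdeal)
    (he : 𝔭.asIdeal.ramificationIdx (NumberField.RingOfIntegers ℚ) = 1)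
    (hf : 𝔭.asIdeal.inertiaDeg (NumberField.RingOfIntegers ℚ) = 1)
    (𝔭' : IsDedekindDomain.HeightOneSpectrum (NumberField.RingOfIntegers K))
    (h𝔭' : ((3 : ℕ) : NumberField.RingOfIntegers K) ∈ 𝔭'.asIdeal) (hne : 𝔭' ≠ 𝔭)
    (ι' : PadicAlgCl 3 ≃+* ℂ)
    (hι : Summit.BirchSwinnertonDyer.BirchSwinnertonDyer.Theorems.SchneiderFree.BranchInducesPrime 3 ι' 𝔭)
    (ΩK : ℂ) (Ωp : ℂ_[3]) (L' : Literature.NumberTheory.EllipticCurves.UnrSeries 3) (hΩK : ΩK ≠ 0) (hΩp : Ωp ≠ 0)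
    (hL : Literature.NumberTheory.EllipticCurves.IsBDPLFunction ι' 𝔭 κ γ Dt'.f ΩK Ωp L')
    (hμ : ∃ i : ℕ, ‖((PowerSeries.coeff i L' : unrIntegers 3) : ℂ_[3])‖ = 1) :
    Module.IsTorsion (IwasawaAlgebra 3)
        (Summit.BirchSwinnertonDyer.Rank1Residual.X11b.AcSelmer.XAc (W'.baseChange K) 3 κ 𝔭' ∅ γ) ∧
      ∃ g' : UnrSeries 3,
        (Summit.BirchSwinnertonDyer.Rank1Residual.X11b.AcSelmer.XAc.charIdeal (W'.baseChange K) 3 κ 𝔭' ∅ γ).map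
            (PowerSeries.map (Summit.BirchSwinnertonDyer.Rank1Residual.X11b.Halves.toUnr 3)) = Ideal.span {g'} ∧
          ∃ i : ℕ, ‖((PowerSeries.coeff i g' : unrIntegers 3) : ℂ_[3])‖ = 1 := by
  have hroots : ∀ m : ℕ, 1 ≤ m → ∃ ζ : ℂ_[3], IsPrimitiveRoot ζ (3 ^ m) :=
    fun m _ ↦ exists_isPrimitiveRoot_padicComplex m
  have hval : ∀ (L : UnrSeries 3) (m : ℕ), 1 ≤ m → ∀ ζ : ℂ_[3], IsPrimitiveRoot ζ (3 ^ m) →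
      ∃ v, L.HasValueAt (ζ - 1) v := by
    intro L m hm ζ hζ
    refine exists_hasValueAt L ?_
    -- ‖ζ - 1‖ ^ φ(3^m) = 3⁻¹ < 1 with φ(3^m) ≥ 1 forces ‖ζ - 1‖ < 1
    have hφ := primitiveRootNormAtThree_holds m hm ζ hζ
    by_contra hge
    push_neg at hge
    have : (1 : ℝ) ≤ ‖ζ - 1‖ ^ Nat.totient (3 ^ m) := one_le_pow₀ hge
    rw [hφ] at this
    norm_num at this
  exact conclusion_of_frequentlyBoundedCharLayers (W'.baseChange K) κ 𝔭' γ
    (frequentlyBoundedCharLayers_of_squeezeSparse hK hP1 primitiveRootNormAtThree_holds hroots hval W' N' K Dt' hbucket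
      hsurj hN
      hK' hH hodd κ hκ γ 𝔭 h𝔭 he hf 𝔭' h𝔭' hne ι' hι ΩK Ωp L' hΩK hΩp hL hμ)

/-! ### §7 P1 PROVED (elementary ultrametric estimate — no Weierstrass preparation, no discreteness of `R₀`) -/

/-- **TRANSFER along sparse levels (PROVED, concludes the crux BY NAME): `C⁺_sparse → (frame ∧ analytic μ = 0) → TwinAlgMuZeroAtThree`.** -/
theorem TwinAlgMuZeroAtThree_of_onePointSqueezeSparse (hK : TwistedOnePointKolyvaginAtThreeSparse)
    (hS : TwinFrameMuSupplyAtThree) :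
    Summit.BirchSwinnertonDyer.BirchSwinnertonDyer.Theses.UniversalToricDescent.TwinAlgMuZeroAtThree := by
  intro W' _ _ N' _ K _ _ Dt' hbucket hsurj hN hK' hH hodd κ hκ γ _ 𝔭 h𝔭 he hf 𝔭' h𝔭' hne
  obtain ⟨ι', hι, ΩK, Ωp, L', hΩK, hΩp, hL, hμ⟩ :=
    hS W' N' K Dt' hbucket hsurj hN hK' hH hodd κ hκ γ 𝔭 h𝔭 he hf 𝔭' h𝔭' hne
  exact twinAlgMuZero_conclusion_of_squeezeSparse hK unitCoeffValuesAtTorsionPoints_holds W' N' K Dt' hbucket hsurj hN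
    hK' hH hodd κ hκ γ 𝔭 h𝔭 he hf 𝔭' h𝔭' hne ι' hι ΩK Ωp L' hΩK hΩp hL hμ

end Summit.BirchSwinnertonDyer.BirchSwinnertonDyer.Cruxes.TwinAlgMuZeroAtThree.OnePointSqueeze

end
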